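/-
Copyright (c) 2026. All rights reserved.
Released under Apache 2.0 license as described in the file LICENSE.
-/
import Literature.AlgebraicGeometry.ComplexMultiplication.HyperellipticJacobianFourTimesPrimeLevelExceptionalClasses
import Literature.AlgebraicGeometry.ComplexMultiplication.HyperellipticJacobianStablyNondegenerateClassification
import HarnessLib

/-!
# The exceptional Hodge classes of the degenerate `J_m = J(y² = x^m − 1)` LOCATED: `J_{40}` on `X_8 × X_{40}` (codimension `3`),
# `J_{48}` on `X_{16} × X_{48}` (codimension `2`); every degenerate `J_m` carries one on at most two pieces, hence ON ITSELF; and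
# `B(J_m) = D(J_m)` iff `m ∈ {p, 2p, 2^k, m ∣ 24, 20}` iff `J_m` is stably nondegenerate

Layer `Literature/AlgebraicGeometry/ComplexMultiplication`, namespace `…ComplexMultiplication.HyperellipticJacobian`; the sequel of
`HyperellipticJacobianFourTimesPrimeLevelExceptionalClasses` (F39: the classes of `J_{4p}` located on `X_{4p}` resp. `X_4 × X_{4p}`) and of
`HyperellipticJacobianStablyNondegenerateClassification` (F38: `J_m` stably nondegenerate iff `m ∈ {p, 2p, 2^k, m ∣ 24, 20}`; for `40 ∣ m` and
`48 ∣ m` only «SOME POWER of a product of pieces carries an exceptional class», power and codimension not located).  THIS FILE locates the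
classes of `J_{40}` and `J_{48}`, hence of every degenerate `J_m`, on the Jacobian ITSELF.  THEOREMS ONLY (no definition, no named fact, no
`sorry`, no instance); the two level-specific inputs are finite facts about `ℤ/40` and `ℤ/48` checked by the kernel (`decide`).

## The print

* A. Gallese, H. Goodson, D. Lombardo, *Monodromy groups and exceptional Hodge classes, I: Fermat Jacobians* [GalleseGoodsonLombardo2024]
  (held `paper:arxiv-2405.20394`, p0003–p0005 read first-hand), §1 p. 3: «Such abelian varieties are usually degenerate if `m` is composite
  (in particular, this happens for all odd composite `m`, see [Heidi])»; p. 4: «the Jacobian varieties `J_m` were studied by Shioda in [Shioda3],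
  where he proved the Hodge conjecture for `J_m` for infinite families of values of `m`, including some for which `J_m` is degenerate. It can be
  shown that in most cases the Hodge ring of `J_m` contains exceptional Hodge cycles (see [Shioda3] and [Heidi])»; §3 THEOREM 3.0
  («`J_m ∼ ∏_{d ∣ m, d ≠ 1,2} X_d`.  The abelian variety `X_d` has dimension `φ(d)/2` …»); §3.2 LEMMA 11 (the CM type of `X_d` is the
  LOWER HALF `Φ_d = {σ_j : (j,d) = 1, 1 ≤ j < d/2}`).
* H. Goodson, *An exploration of degeneracy in abelian varieties of Fermat type* [Goodson2024DegeneracyFermat] Thm. 1.1 (odd composite `m`: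
  an exceptional class of codimension `(p+1)/2`, `p = minFac m`, carried by `X_m × X_{m/p}` — the tree's `exists_exceptional_of_minFac`).
* Z. Gao, E. Ullmo [GaoUllmo2025] Thm. 3.1 (Pohlmann's theorem for a CM pair `(E, Φ)` with `E` a CM ALGEBRA — the tree's
  `Pohlmann1968/{HodgeClassesCMAlgebra, DivisorClassesCMAlgebra}`: `B^r(⨁ A_i) ⊗ ℂ` indexed by the Galois-balanced `2r`-subsets of
  `⊔_i Hom(K_i, ℂ)` (`pohlmannSetsAlg`), `D^r ⊗ ℂ` by the disjoint unions of balanced pairs (`pohlmannDivisorSetsAlg`), and the criterion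
  `exists_exceptional_biproduct_iff`); H. Pohlmann [Pohlmann1968] Thm. 1; B. B. Gordon [Gordon1999HodgeAVSurvey] 7.5–7.6.1 (stable nondegeneracy;
  Hazama's remark on direct factors), 9.2.2 (White's count), §9.3; B. van Geemen [vanGeemen1994HodgeAV] §2.4–2.5, §3.6–3.7 (pull-backs of divisor
  classes; isogeny direct summands).

## The argument typed here

§0.  An exceptional Hodge class ASCENDS along a retraction `t ≫ h = [n]` (`n ≠ 0`): if `c ∈ B^p(I) ∖ D^p(I) ⊗ ℂ` then `h^* c ∈ B^p(J)` and
`h^* c ∉ D^p(J) ⊗ ℂ`, for otherwise `n^{2p} c = t^* h^* c ∈ D^p(I) ⊗ ℂ` (the degreewise contrapositive of the tree's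
`IsDivisorGenerated.of_comp_eq_nsmul_id`); hence from a sub-biproduct `⨁_a C_{v a}` (`v` injective) or a summand `C_j` to `⨁_j C_j`.
§1.  POHLMANN'S CRITERION IN CERTIFICATE FORM.  For a family `(ℚ(ζ_{d_i}), Φ_i)_{i<k}` of lower-half types at levels `d_i ∣ M`, the Galois
action on `⊔_i Hom(ℚ(ζ_{d_i}), ℂ)` is read on `ℤ/M` by the lift `(i, σ) ↦ (M/d_i)·e(σ)`: `τ ∘ σ ∈ Φ_i ⟺ 2⟨u_M(τ)·lift⟩ < M` (the tree's
`comp_mem_iff_half_lift`), and `σ ↦ e(σ)` is a bijection of `Hom(ℚ(ζ_d), ℂ)` onto the units of `ℤ/d` (`card_filter_member_eq`).  A weight `W`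
on two members `i₁ ≠ i₂` (levels `d₁, d₂`) cut out by predicates `P₁, P₂` on the lifted exponents is therefore Galois-balanced as soon as,
for every unit `g` of `ℤ/M`, `#{units e of ℤ/d_j : P_j((M/d_j)e), 2⟨g·(M/d_j)e⟩ < M}` summed over `j = 1, 2` equals the complementary count
(`isGaloisBalancedAlg_weightPair_of_forall_units`; every `τ` acts through the unit `u_M(τ)`); and `W` is NOT a disjoint union of balanced pairs
as soon as one of its points `(i₁, σ_{e₀})` has no balanced partner inside `W` — for every other point some unit `g` (realised by some `τ`,
`exists_autExp_eq`) moves both points to the same side (`weightPair_notMem_pohlmannDivisorSetsAlg_of_forall_exists_unit`; in a disjoint union of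
balanced pairs every point has a partner, Gordon 9.2.2).  Both certificates, and `|W| = 2r`, are decidable statements about `ℤ/M` once
`M, d₁, d₂, P₁, P₂` are numerals (`weightPair_mem_pohlmannSetsAlg_diff`).
§2–§3.  THE WEIGHTS (found by exhaustive search over the `16` units of `ℤ/40` resp. `ℤ/48` acting on the `38` resp. `46` embeddings of
`⊔_{d ∣ M, d ≥ 3} Hom(ℚ(ζ_d), ℂ)`, then certified by the kernel): `W_{40} = Φ_8 ⊔ {σ_7, σ_21, σ_23, σ_29}` — BOTH embeddings of the type of
`X_8` (`e ∈ {1, 3}`, lifts `5, 15`; the `(2,0)`-part of `X_8`) and four embeddings of `ℚ(ζ_40)` — is balanced of size `6` and `(i₁, σ_1)` has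
no partner: a class of type `(3,3)` on `X_8 × X_{40}`; `W_{48} = {σ_1, σ_3} ⊔ {σ_25, σ_31}` (levels `16`, lifts `3, 9`; and `48`) is balanced of
size `4` without partners: a class of type `(2,2)` on `X_{16} × X_{48}`.  NUMERICS ONLY (not typed): for `M = 40` there is NO balanced
non-divisorial weight of size `2` or `4` on any product of pieces and there are exactly `32` of size `6`, all supported on `X_8 × X_{40}`
(so `dim B³ − dim D³ = 32` there and no exceptional class of codimension `≤ 2` exists on any product of pieces of `J_{40}`); for `M = 48`
none of size `2` and exactly `64` of size `4`, all on `X_{16} × X_{48}`; the pattern continues as «`X_{2^a} × X_{2^a p}`, codimension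
`(p+1)/2`» (`X_8 × X_{56}`: codim `4`; `X_{16} × X_{80}`: codim `3`; `X_{32} × X_{96}`: codim `2`), untyped.

## What is proved

* §0 `exists_exceptional_of_comp_eq_nsmul_id`, `exists_exceptional_biproduct_of_comp_injective` (and §4 `exists_exceptional_biproduct_of_summand`,
  `exists_exceptional_biproduct_of_pair`): exceptional classes ascend along retractions ∕ from sub-biproducts ∕ summands.
* §1 (certificate form, any `M`): `card_filter_member_eq`, `card_filter_weightPair_eq`, `card_weightPair_eq`,
  **`isGaloisBalancedAlg_weightPair_of_forall_units`**, **`weightPair_notMem_pohlmannDivisorSetsAlg_of_forall_exists_unit`**,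
  **`weightPair_mem_pohlmannSetsAlg_diff`**.
* §2 (`M = 40`; members `i₁, i₂` of levels `8, 40` in a family of lower-half types at levels `d_i ∣ 40`): **`weightForty_mem_pohlmannSetsAlg_diff`**
  (`W_{40} ∈ pohlmannSetsAlg Φ 3 ∖ pohlmannDivisorSetsAlg Φ 3`), **`exists_exceptional_of_levels_eight_forty`** — `⨁_i A_i` (e.g. `X_8 × X_{40}`,
  `J_{40}`) CARRIES A RATIONAL `(3,3)`-CLASS OUTSIDE `𝓓³ ⊗ ℂ` — and `not_isNondegenerateFamily_of_levels_eight_forty`.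
* §3 (`M = 48`; levels `16, 48`): **`weightFortyEight_mem_pohlmannSetsAlg_diff`**, **`exists_exceptional_of_levels_sixteen_fortyEight`** (a rational
  `(2,2)`-class outside `𝓓² ⊗ ℂ`), `not_isNondegenerateFamily_of_levels_sixteen_fortyEight`.
* §4 (the `J_m`-family: one realisation `C_j ⊨ (ℚ(ζ_{e_j}); Ψ_j)` of the lower-half type at each divisor `e ≥ 3` of `m`):
  `exists_exceptional_pair_of_lev_eq_eight_forty` ∕ `_of_forty_dvd` (`X_8 × X_{40}`, dimension `10`, codimension `3`; `40 ∣ m`),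
  `exists_exceptional_pair_of_lev_eq_sixteen_fortyEight` ∕ `_of_fortyEight_dvd` (`X_{16} × X_{48}`, dimension `12`, codimension `2`; `48 ∣ m`),
  `exists_exceptional_pair_of_lev_eq_odd_composite` ∕ `_of_odd_composite_dvd` (Goodson's class read on the two pieces `X_d × X_{d/minFac d}`),
  **`exists_exceptional_located`** — for `m` with an odd composite divisor, or `4p ∣ m` (`p ≥ 7`), or `40 ∣ m`, or `48 ∣ m`, an exceptional
  Hodge class on ONE or TWO explicitly named pieces in an explicit codimension —, **`exists_exceptional_biproduct_of_levels`** and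
  **`not_isDivisorGenerated_biproduct_of_levels`** — `J_m = ⨁_j C_j` ITSELF carries an exceptional Hodge class —, and the classification
  **`isDivisorGenerated_biproduct_iff`**: for `m ≥ 3`, `B(J_m) = D(J_m)` iff `m` is an odd prime, or `2p`, or `2^k` (`k ≥ 2`), or `m ∣ 24`, or
  `m = 20`; **`isDivisorGenerated_biproduct_iff_isStablyNondegenerate`**: iff `J_m` is stably nondegenerate (F38) — for these Jacobians
  degeneracy never needs a power to appear.

HONEST REGISTER.  «`X_d`», «`J_m`» are the abstract realisations ∕ biproduct (Thm. 3.0 read as hypothesis), as in F24–F39; the curve and the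
isogeny `J_m ∼ ∏ X_d` are not constructed.  The LOCATIONS at `40` and `48` (the weights `W_{40}`, `W_{48}`, their codimensions, the pieces) are
ASSEMBLED — found by search and certified by the kernel through Pohlmann's criterion in the CM-algebra form; neither GGL paper nor Goodson
prints them, and the minimality ∕ counting statements above are numerics only.  The classification `B(J_m) = D(J_m) ⟺ m ∈ {…}` is assembled
from F35 ∕ F38 (positive list), Goodson Thm. 1.1, F39 and §2–§3; GGL print only «in most cases».  NOTHING here is an algebraicity statement:
an exceptional Hodge class is one outside the span of products of divisor classes; whether it is algebraic — the Hodge conjecture for the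
degenerate `J_m`, known in Shioda's cases (GGL's [Shioda3] = [Shioda1981FermatType], Math. Ann. 258), which are not typed in the tree — is
untouched, and `HC_CM` is not touched.

## Provenance

Cell `pub-hodgecm2` (COR-CM), KEPT Literature lane `lit-deligne-3` gen 55 (claim GGL24-DEGENERATE-LEVELS-LOCATED; count-neutral, own lane).
-/

noncomputable section

open CategoryTheory CategoryTheory.Limits NumberField Module

namespace Literature.AlgebraicGeometry.ComplexMultiplication

open Literature.AlgebraicGeometry.Motives
open Literature.AlgebraicGeometry.Motives.AbelianVariety
open Literature.AlgebraicGeometry.HodgeTheory (complexBetti IsRationalClass IsOfHodgeType IsStablyNondegenerate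
  IsDivisorGenerated)
open Literature.AlgebraicGeometry.VanGeemen1994 (hodgeClassSpan)
open Literature.Barriers.HodgeConjecture (divisorClassesSpan)
open Literature.NumberTheory.ComplexMultiplication

namespace HyperellipticJacobian

open Literature.AlgebraicGeometry.Pohlmann1968 Literature.AlgebraicGeometry.Pohlmann1968.Cyclotomic
open Literature.AlgebraicGeometry.Pohlmann1968.CMAlgebra

/-! ## §0 Exceptional Hodge classes ascend along retractions and from sub-biproducts -/

section Transport

/-- **An exceptional Hodge class ascends along a retraction.**  If `t : I ⟶ J`, `h : J ⟶ I` satisfy `t ≫ h = [n]`, `n ≠ 0`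
(`I` a direct summand of `J` up to isogeny) and `I` carries a rational `(p,p)`-class `c` outside `Dᵖ(I) ⊗ ℂ`, then `h^* c` is a
rational `(p,p)`-class on `J` outside `Dᵖ(J) ⊗ ℂ`: otherwise `n^{2p} c = t^* h^* c ∈ t^*(Dᵖ(J) ⊗ ℂ) ⊆ Dᵖ(I) ⊗ ℂ` (pull-backs of
products of divisor classes are products of divisor classes).  The contrapositive, degree by degree, of the tree's
`IsDivisorGenerated.of_comp_eq_nsmul_id`. [cite: vanGeemen1994HodgeAV, §2.4–2.5 (p. 235) and §3.6–3.7 (p. 236)]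
[cite: Gordon1999HodgeAVSurvey, 7.6.1] -/
theorem exists_exceptional_of_comp_eq_nsmul_id {I J : AbelianVariety ℂ} (t : I ⟶ J) (h : J ⟶ I) {n : ℕ} (hn : n ≠ 0)
    (hth : t ≫ h = n • 𝟙 I) {p : ℕ}
    (hI : ∃ c : complexBetti I.X (2 * p), IsRationalClass c ∧ IsOfHodgeType I.dim I.X (2 * p) p p c ∧
      c ∉ divisorClassesSpan I.X I.dim p) :
    ∃ c : complexBetti J.X (2 * p), IsRationalClass c ∧ IsOfHodgeType J.dim J.X (2 * p) p p c ∧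
      c ∉ divisorClassesSpan J.X J.dim p := by
  obtain ⟨c, hcQ, hcH, hcD⟩ := hI
  have h1 := HodgeTheory.AbelianVariety.mapsTo_hodgeClasses h p ⟨hcQ, hcH⟩
  refine ⟨HodgeTheory.complexBetti.map h.hom.hom.hom (2 * p) c, h1.1, h1.2, fun hmem => hcD ?_⟩
  have h2 : HodgeTheory.complexBetti.map t.hom.hom.hom (2 * p) (HodgeTheory.complexBetti.map h.hom.hom.hom (2 * p) c) ∈
      divisorClassesSpan I.X I.dim p :=
    HodgeTheory.AbelianVariety.map_mem_divisorClassesSpan t hmem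
  rw [HodgeTheory.complexBetti_map_map_of_comp_eq_nsmul_id hth] at h2
  have hn' : ((n : ℂ) ^ (2 * p)) ≠ 0 := pow_ne_zero _ (Nat.cast_ne_zero.2 hn)
  have h3 := Submodule.smul_mem (divisorClassesSpan I.X I.dim p) (((n : ℂ) ^ (2 * p))⁻¹) h2
  rwa [smul_smul, inv_mul_cancel₀ hn', one_smul] at h3

/-- **An exceptional Hodge class on a sub-biproduct is an exceptional Hodge class on the biproduct** (Hazama's remark, Gordon 7.6.1:
direct factors): for an injective re-indexing `v : ι → κ`, `⨁_a C_{v a}` is a retract of `⨁_j C_j` (summand inclusions ∕ projections,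
`t ≫ r = 𝟙`), and the class is pulled back along the projection `r`. [cite: Gordon1999HodgeAVSurvey, 7.6.1]
[cite: vanGeemen1994HodgeAV, §2.4–2.5 (p. 235) and §3.6–3.7 (p. 236)] -/
theorem exists_exceptional_biproduct_of_comp_injective {κ ι : Type} [Fintype κ] [DecidableEq κ] [Fintype ι] [DecidableEq ι]
    (C : κ → AbelianVariety ℂ) {v : ι → κ} (hv : Function.Injective v) {p : ℕ}
    (h : ∃ c : complexBetti (⨁ fun a => C (v a)).X (2 * p), IsRationalClass c ∧
      IsOfHodgeType (⨁ fun a => C (v a)).dim (⨁ fun a => C (v a)).X (2 * p) p p c ∧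
      c ∉ divisorClassesSpan (⨁ fun a => C (v a)).X (⨁ fun a => C (v a)).dim p) :
    ∃ c : complexBetti (⨁ C).X (2 * p), IsRationalClass c ∧ IsOfHodgeType (⨁ C).dim (⨁ C).X (2 * p) p p c ∧
      c ∉ divisorClassesSpan (⨁ C).X (⨁ C).dim p := by
  let t : (⨁ fun a => C (v a)) ⟶ ⨁ C := biproduct.desc fun a => biproduct.ι C (v a)
  let r : (⨁ C) ⟶ ⨁ fun a => C (v a) := biproduct.lift fun a => biproduct.π C (v a)
  have htr : t ≫ r = (1 : ℕ) • 𝟙 (⨁ fun a => C (v a)) := by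
    rw [one_smul]
    apply biproduct.hom_ext'
    intro a
    apply biproduct.hom_ext
    intro b
    simp only [t, r, Category.assoc, biproduct.ι_desc_assoc, biproduct.lift_π, Category.comp_id]
    by_cases hab : a = b
    · subst hab
      rw [biproduct.ι_π_self, biproduct.ι_π_self]
    · rw [biproduct.ι_π_ne _ (fun h => hab (hv h)), biproduct.ι_π_ne _ hab]
  exact exists_exceptional_of_comp_eq_nsmul_id t r one_ne_zero htr h

end Transport

/-! ## §1 Pohlmann's criterion in CERTIFICATE FORM for a weight on two members of a family of lower-half types

Families `(K_i, Φ_i)_{i<k}` of lower-half types (`σ ∈ Φ_i ⟺ 2⟨e(σ)⟩ < d_i`) at levels `d_i ∣ M`, read on `ℤ/M` through the lift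
`(i, σ) ↦ (M/d_i)·e(σ)` (`HyperellipticJacobianExceptionalClasses.comp_mem_iff_half_lift`: `τ ∘ σ ∈ Φ_i ⟺ 2⟨u_M(τ)·lift⟩ < M`).  A weight
on two members `i₁ ≠ i₂` of levels `d₁, d₂` is given by two predicates `P₁, P₂` on `ℤ/M` (the lifted exponents kept on each member).  Its
Galois balance (Pohlmann's condition, Gao–Ullmo (3.2)) is EQUIVALENT to a finite count over the units of `ℤ/M`, and a point of the weight
without a balanced partner inside the weight certifies that the weight is not a disjoint union of balanced pairs — both decidable once
`M, d₁, d₂, P₁, P₂` are numerals. -/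

section Certificate

variable {k : ℕ} {lev : Fin k → ℕ} [∀ i, NeZero (lev i)] {K : Fin k → Type} [∀ i, Field (K i)]
  [∀ i, NumberField (K i)] [∀ i, IsCyclotomicExtension {lev i} ℚ (K i)] {Φ : ∀ i, CMType (K i)}
  {M : ℕ} [NeZero M]

omit [NeZero M] in
/-- **Counting the part of a weight on ONE member on the units of `ℤ/d`**: for a member `i` of level `d ∣ M` and a property `P` of the
lifted exponent, `#{(i, σ) : P((M/d)·e(σ))} = #{units e of ℤ/d : P((M/d)·e)}` — `σ ↦ e(σ)` is a bijection of `Hom(ℚ(ζ_d), ℂ)` onto the units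
of `ℤ/d`. [cite: Washington1997, Thm. 2.5] -/
theorem card_filter_member_eq {i : Fin k} {d : ℕ} [NeZero d] (h : lev i = d) (P : ZMod M → Prop) [DecidablePred P] :
    (Finset.univ.filter fun x : (i : Fin k) × (K i →+* ℂ) =>
        x.1 = i ∧ P ((M / lev x.1 * (expOf (lev x.1) (K x.1) x.2).val : ℕ) : ZMod M)).card =
      (Finset.univ.filter fun e : ZMod d => e.val.Coprime d ∧ P ((M / d * e.val : ℕ) : ZMod M)).card := by
  subst h
  classical
  symm
  refine Finset.card_bij
    (fun e he => (⟨i, Classical.choose (exists_expOf_eq (lev i) (K i) e (Finset.mem_filter.1 he).2.1)⟩ :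
      (i : Fin k) × (K i →+* ℂ)))
    (fun e he => ?_) (fun e he e' he' hee => ?_) (fun x hx => ?_)
  · have hspec := Classical.choose_spec (exists_expOf_eq (lev i) (K i) e (Finset.mem_filter.1 he).2.1)
    refine Finset.mem_filter.2 ⟨Finset.mem_univ _, rfl, ?_⟩
    dsimp only
    rw [hspec]
    exact (Finset.mem_filter.1 he).2.2
  · have h1 := Classical.choose_spec (exists_expOf_eq (lev i) (K i) e (Finset.mem_filter.1 he).2.1)
    have h2 := Classical.choose_spec (exists_expOf_eq (lev i) (K i) e' (Finset.mem_filter.1 he').2.1)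
    have hσ := eq_of_heq (Sigma.mk.inj hee).2
    exact h1.symm.trans ((congrArg (expOf (lev i) (K i)) hσ).trans h2)
  · obtain ⟨i', σ⟩ := x
    have hx' := (Finset.mem_filter.1 hx).2
    have hi : i' = i := hx'.1
    subst hi
    have hspec : ∀ hc : (expOf (lev i') (K i') σ).val.Coprime (lev i'),
        Classical.choose (exists_expOf_eq (lev i') (K i') _ hc) = σ :=
      fun hc => expOf_injective (lev i') (K i') (Classical.choose_spec (exists_expOf_eq (lev i') (K i') _ hc))
    exact ⟨expOf (lev i') (K i') σ, Finset.mem_filter.2 ⟨Finset.mem_univ _, coprime_expOf (lev i') (K i') σ, hx'.2⟩,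
      congrArg (Sigma.mk i') (hspec (coprime_expOf (lev i') (K i') σ))⟩

omit [NeZero M] in
/-- **Counting a two-member weight with an extra property of the lift**: the weight `W(P₁, P₂)` on the members `i₁ ≠ i₂` (levels `d₁`,
`d₂`) filtered by a property `Q` of the lifted exponent is counted on the units of `ℤ/d₁` and of `ℤ/d₂`. [cite: Washington1997, Thm. 2.5] -/
theorem card_filter_weightPair_eq {i₁ i₂ : Fin k} (hne : i₁ ≠ i₂) {d₁ d₂ : ℕ} [NeZero d₁] [NeZero d₂]
    (h₁ : lev i₁ = d₁) (h₂ : lev i₂ = d₂) (P₁ P₂ Q : ZMod M → Prop) [DecidablePred P₁] [DecidablePred P₂] [DecidablePred Q] :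
    ((Finset.univ.filter fun x : (i : Fin k) × (K i →+* ℂ) =>
      (x.1 = i₁ ∧ P₁ ((M / lev x.1 * (expOf (lev x.1) (K x.1) x.2).val : ℕ) : ZMod M)) ∨
      (x.1 = i₂ ∧ P₂ ((M / lev x.1 * (expOf (lev x.1) (K x.1) x.2).val : ℕ) : ZMod M))).filter
      fun x => Q ((M / lev x.1 * (expOf (lev x.1) (K x.1) x.2).val : ℕ) : ZMod M)).card =
      (Finset.univ.filter fun e : ZMod d₁ => e.val.Coprime d₁ ∧ P₁ ((M / d₁ * e.val : ℕ) : ZMod M) ∧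
          Q ((M / d₁ * e.val : ℕ) : ZMod M)).card +
        (Finset.univ.filter fun e : ZMod d₂ => e.val.Coprime d₂ ∧ P₂ ((M / d₂ * e.val : ℕ) : ZMod M) ∧
          Q ((M / d₂ * e.val : ℕ) : ZMod M)).card := by
  classical
  rw [Finset.filter_filter]
  have e : (Finset.univ.filter fun x : (i : Fin k) × (K i →+* ℂ) =>
      ((x.1 = i₁ ∧ P₁ ((M / lev x.1 * (expOf (lev x.1) (K x.1) x.2).val : ℕ) : ZMod M)) ∨
        (x.1 = i₂ ∧ P₂ ((M / lev x.1 * (expOf (lev x.1) (K x.1) x.2).val : ℕ) : ZMod M))) ∧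
        Q ((M / lev x.1 * (expOf (lev x.1) (K x.1) x.2).val : ℕ) : ZMod M)) =
      (Finset.univ.filter fun x : (i : Fin k) × (K i →+* ℂ) => x.1 = i₁ ∧
        (P₁ ((M / lev x.1 * (expOf (lev x.1) (K x.1) x.2).val : ℕ) : ZMod M) ∧
          Q ((M / lev x.1 * (expOf (lev x.1) (K x.1) x.2).val : ℕ) : ZMod M))) ∪
      (Finset.univ.filter fun x : (i : Fin k) × (K i →+* ℂ) => x.1 = i₂ ∧
        (P₂ ((M / lev x.1 * (expOf (lev x.1) (K x.1) x.2).val : ℕ) : ZMod M) ∧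
          Q ((M / lev x.1 * (expOf (lev x.1) (K x.1) x.2).val : ℕ) : ZMod M))) := by
    ext x
    simp only [Finset.mem_filter, Finset.mem_univ, true_and, Finset.mem_union]
    tauto
  rw [e, Finset.card_union_of_disjoint (Finset.disjoint_filter.2 fun x _ h h' => hne (h.1.symm.trans h'.1)),
    card_filter_member_eq h₁ (P := fun t => P₁ t ∧ Q t), card_filter_member_eq h₂ (P := fun t => P₂ t ∧ Q t)]

omit [NeZero M] in
/-- **The size of a two-member weight**: `|W(P₁, P₂)| = #{units e of ℤ/d₁ : P₁((M/d₁)e)} + #{units e of ℤ/d₂ : P₂((M/d₂)e)}`.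
[cite: Washington1997, Thm. 2.5] -/
theorem card_weightPair_eq {i₁ i₂ : Fin k} (hne : i₁ ≠ i₂) {d₁ d₂ : ℕ} [NeZero d₁] [NeZero d₂]
    (h₁ : lev i₁ = d₁) (h₂ : lev i₂ = d₂) (P₁ P₂ : ZMod M → Prop) [DecidablePred P₁] [DecidablePred P₂] :
    (Finset.univ.filter fun x : (i : Fin k) × (K i →+* ℂ) =>
      (x.1 = i₁ ∧ P₁ ((M / lev x.1 * (expOf (lev x.1) (K x.1) x.2).val : ℕ) : ZMod M)) ∨
      (x.1 = i₂ ∧ P₂ ((M / lev x.1 * (expOf (lev x.1) (K x.1) x.2).val : ℕ) : ZMod M))).card =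
      (Finset.univ.filter fun e : ZMod d₁ => e.val.Coprime d₁ ∧ P₁ ((M / d₁ * e.val : ℕ) : ZMod M)).card +
        (Finset.univ.filter fun e : ZMod d₂ => e.val.Coprime d₂ ∧ P₂ ((M / d₂ * e.val : ℕ) : ZMod M)).card := by
  classical
  have h := card_filter_weightPair_eq (K := K) (M := M) hne h₁ h₂ P₁ P₂ (fun _ => True)
  rw [Finset.filter_true_of_mem fun x _ => trivial] at h
  simp only [and_true] at h
  exact h

/-- **POHLMANN'S CONDITION FOR A TWO-MEMBER WEIGHT, CERTIFICATE FORM.**  For a family of lower-half types at levels `d_i ∣ M` and the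
weight `W(P₁, P₂)` on the members `i₁ ≠ i₂` of levels `d₁, d₂`: if for every unit `g` of `ℤ/M` the members of `W` moved into their
types by (an automorphism of character) `g` — counted on the units `e` of `ℤ/d₁`, `ℤ/d₂` as `2⟨g·(M/d_j)e⟩ < M` — are as many as those
moved out, then `W` satisfies Pohlmann's condition (3.2) for the CM algebra `∏_i ℚ(ζ_{d_i})` (every `τ ∈ Aut(ℂ)` acts through its
cyclotomic character `u_M(τ)`, a unit). [cite: GaoUllmo2025, Thm. 3.1 (3.2)] [cite: Pohlmann1968, Thm. 1]
[cite: GalleseGoodsonLombardo2024, §3.2 Lemma 11] -/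
theorem isGaloisBalancedAlg_weightPair_of_forall_units (hdvd : ∀ i, lev i ∣ M)
    (hΦ : ∀ i (σ : K i →+* ℂ), σ ∈ (Φ i).1 ↔ 2 * (expOf (lev i) (K i) σ).val < lev i)
    {i₁ i₂ : Fin k} (hne : i₁ ≠ i₂) {d₁ d₂ : ℕ} [NeZero d₁] [NeZero d₂] (h₁ : lev i₁ = d₁) (h₂ : lev i₂ = d₂)
    (P₁ P₂ : ZMod M → Prop) [DecidablePred P₁] [DecidablePred P₂]
    (hbal : ∀ g : ZMod M, g.val.Coprime M →
      (Finset.univ.filter fun e : ZMod d₁ => e.val.Coprime d₁ ∧ P₁ ((M / d₁ * e.val : ℕ) : ZMod M) ∧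
          2 * (g * ((M / d₁ * e.val : ℕ) : ZMod M)).val < M).card +
        (Finset.univ.filter fun e : ZMod d₂ => e.val.Coprime d₂ ∧ P₂ ((M / d₂ * e.val : ℕ) : ZMod M) ∧
          2 * (g * ((M / d₂ * e.val : ℕ) : ZMod M)).val < M).card =
      (Finset.univ.filter fun e : ZMod d₁ => e.val.Coprime d₁ ∧ P₁ ((M / d₁ * e.val : ℕ) : ZMod M) ∧
          ¬2 * (g * ((M / d₁ * e.val : ℕ) : ZMod M)).val < M).card +
        (Finset.univ.filter fun e : ZMod d₂ => e.val.Coprime d₂ ∧ P₂ ((M / d₂ * e.val : ℕ) : ZMod M) ∧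
          ¬2 * (g * ((M / d₂ * e.val : ℕ) : ZMod M)).val < M).card) :
    IsGaloisBalancedAlg Φ (Finset.univ.filter fun x : (i : Fin k) × (K i →+* ℂ) =>
      (x.1 = i₁ ∧ P₁ ((M / lev x.1 * (expOf (lev x.1) (K x.1) x.2).val : ℕ) : ZMod M)) ∨
      (x.1 = i₂ ∧ P₂ ((M / lev x.1 * (expOf (lev x.1) (K x.1) x.2).val : ℕ) : ZMod M))) := by
  classical
  intro τ
  set W := Finset.univ.filter fun x : (i : Fin k) × (K i →+* ℂ) =>
      (x.1 = i₁ ∧ P₁ ((M / lev x.1 * (expOf (lev x.1) (K x.1) x.2).val : ℕ) : ZMod M)) ∨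
      (x.1 = i₂ ∧ P₂ ((M / lev x.1 * (expOf (lev x.1) (K x.1) x.2).val : ℕ) : ZMod M)) with hW
  have hg : (autExp M τ).val.Coprime M := coprime_autExp M τ
  have e1 : {x | x ∈ W ∧ (τ : ℂ →+* ℂ).comp x.2 ∈ (Φ x.1).1} =
      ((W.filter fun x => 2 * (autExp M τ *
        ((M / lev x.1 * (expOf (lev x.1) (K x.1) x.2).val : ℕ) : ZMod M)).val < M : Finset _) : Set _) := by
    ext x
    rw [Set.mem_setOf_eq, Finset.coe_filter, Set.mem_setOf_eq, comp_mem_iff_half_lift (M := M) hdvd hΦ τ x]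
  have e2 : {x | x ∈ W ∧ (τ : ℂ →+* ℂ).comp x.2 ∉ (Φ x.1).1} =
      ((W.filter fun x => ¬2 * (autExp M τ *
        ((M / lev x.1 * (expOf (lev x.1) (K x.1) x.2).val : ℕ) : ZMod M)).val < M : Finset _) : Set _) := by
    ext x
    rw [Set.mem_setOf_eq, Finset.coe_filter, Set.mem_setOf_eq, comp_mem_iff_half_lift (M := M) hdvd hΦ τ x]
  rw [e1, e2, Set.ncard_coe_finset, Set.ncard_coe_finset, hW,
    card_filter_weightPair_eq hne h₁ h₂ P₁ P₂ (fun t => 2 * (autExp M τ * t).val < M),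
    card_filter_weightPair_eq hne h₁ h₂ P₁ P₂ (fun t => ¬2 * (autExp M τ * t).val < M)]
  exact hbal _ hg

omit [∀ i, NumberField (K i)] [∀ i, IsCyclotomicExtension {lev i} ℚ (K i)] in
/-- A pair `{x, y}` whose members are moved by some `τ ∈ Aut(ℂ)` to the SAME side (both into their types, or both out) is not balanced.
[cite: GaoUllmo2025, Thm. 3.1 (3.2)] [cite: Pohlmann1968, Thm. 1] -/
private theorem not_isGaloisBalancedAlg_pair_of_iff [DecidableEq ((i : Fin k) × (K i →+* ℂ))]
    {x y : (i : Fin k) × (K i →+* ℂ)} (hxy : x ≠ y) (τ : ℂ ≃+* ℂ)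
    (hiff : (τ : ℂ →+* ℂ).comp x.2 ∈ (Φ x.1).1 ↔ (τ : ℂ →+* ℂ).comp y.2 ∈ (Φ y.1).1) :
    ¬IsGaloisBalancedAlg Φ ({x, y} : Finset ((i : Fin k) × (K i →+* ℂ))) := by
  intro hbal
  have h := hbal τ
  by_cases hx : (τ : ℂ →+* ℂ).comp x.2 ∈ (Φ x.1).1
  · have hy := hiff.1 hx
    have e1 : {z | z ∈ ({x, y} : Finset ((i : Fin k) × (K i →+* ℂ))) ∧ (τ : ℂ →+* ℂ).comp z.2 ∈ (Φ z.1).1} =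
        (({x, y} : Finset ((i : Fin k) × (K i →+* ℂ))) : Set _) := by
      ext z
      simp only [Set.mem_setOf_eq, Finset.coe_insert, Finset.coe_singleton, Set.mem_insert_iff, Set.mem_singleton_iff,
        Finset.mem_insert, Finset.mem_singleton]
      constructor
      · exact fun hz => hz.1
      · rintro (rfl | rfl)
        · exact ⟨Or.inl rfl, hx⟩
        · exact ⟨Or.inr rfl, hy⟩
    have e2 : {z | z ∈ ({x, y} : Finset ((i : Fin k) × (K i →+* ℂ))) ∧ (τ : ℂ →+* ℂ).comp z.2 ∉ (Φ z.1).1} = ∅ := by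
      ext z
      simp only [Set.mem_setOf_eq, Finset.mem_insert, Finset.mem_singleton, Set.mem_empty_iff_false, iff_false, not_and,
        not_not]
      rintro (rfl | rfl)
      · exact hx
      · exact hy
    rw [e1, e2, Set.ncard_coe_finset, Finset.card_pair hxy, Set.ncard_empty] at h
    exact absurd h (by norm_num)
  · have hy : (τ : ℂ →+* ℂ).comp y.2 ∉ (Φ y.1).1 := fun h' => hx (hiff.2 h')
    have e1 : {z | z ∈ ({x, y} : Finset ((i : Fin k) × (K i →+* ℂ))) ∧ (τ : ℂ →+* ℂ).comp z.2 ∈ (Φ z.1).1} = ∅ := by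
      ext z
      simp only [Set.mem_setOf_eq, Finset.mem_insert, Finset.mem_singleton, Set.mem_empty_iff_false, iff_false, not_and]
      rintro (rfl | rfl)
      · exact hx
      · exact hy
    have e2 : {z | z ∈ ({x, y} : Finset ((i : Fin k) × (K i →+* ℂ))) ∧ (τ : ℂ →+* ℂ).comp z.2 ∉ (Φ z.1).1} =
        (({x, y} : Finset ((i : Fin k) × (K i →+* ℂ))) : Set _) := by
      ext z
      simp only [Set.mem_setOf_eq, Finset.coe_insert, Finset.coe_singleton, Set.mem_insert_iff, Set.mem_singleton_iff,
        Finset.mem_insert, Finset.mem_singleton]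
      constructor
      · exact fun hz => hz.1
      · rintro (rfl | rfl)
        · exact ⟨Or.inl rfl, hx⟩
        · exact ⟨Or.inr rfl, hy⟩
    rw [e1, e2, Set.ncard_empty, Set.ncard_coe_finset, Finset.card_pair hxy] at h
    exact absurd h (by norm_num)

omit [∀ i, NumberField (K i)] [∀ i, IsCyclotomicExtension {lev i} ℚ (K i)] in
/-- In a disjoint union of balanced pairs every point has a balanced partner inside (private copy of the F39 helper).
[cite: Gordon1999HodgeAVSurvey, 9.2.2] -/
private theorem exists_partner_of_mem_pohlmannDivisorSetsAlg' [DecidableEq ((i : Fin k) × (K i →+* ℂ))] {m : ℕ}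
    {T : Finset ((i : Fin k) × (K i →+* ℂ))} (hT : T ∈ pohlmannDivisorSetsAlg Φ m) {x : (i : Fin k) × (K i →+* ℂ)}
    (hx : x ∈ T) : ∃ y ∈ T, y ≠ x ∧ IsGaloisBalancedAlg Φ ({x, y} : Finset ((i : Fin k) × (K i →+* ℂ))) := by
  revert hx
  refine disjointUnionsOf_induction (T := pohlmannSetsAlg Φ 1)
    (P := fun T : Finset ((i : Fin k) × (K i →+* ℂ)) =>
      x ∈ T → ∃ y ∈ T, y ≠ x ∧ IsGaloisBalancedAlg Φ ({x, y} : Finset ((i : Fin k) × (K i →+* ℂ))))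
    (fun h => absurd h (Finset.notMem_empty _)) (fun s t hs ht hst hx => ?_) hT
  rw [Finset.mem_disjUnion] at hx
  rcases hx with hx | hx
  · obtain ⟨y, hy, hne, hbal⟩ := hs hx
    exact ⟨y, Finset.mem_disjUnion.2 (Or.inl hy), hne, hbal⟩
  · obtain ⟨a, b, hab, rfl⟩ := Finset.card_eq_two.1 ht.1
    rw [Finset.mem_insert, Finset.mem_singleton] at hx
    rcases hx with rfl | rfl
    · exact ⟨b, Finset.mem_disjUnion.2 (Or.inr (by simp)), hab.symm, ht.2⟩
    · refine ⟨a, Finset.mem_disjUnion.2 (Or.inr (by simp)), hab, ?_⟩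
      rw [Finset.pair_comm]
      exact ht.2

/-- **NON-DIVISORIALITY, CERTIFICATE FORM.**  If a point `(i₁, σ₀)` of the weight `W(P₁, P₂)` (exponent `e₀`) has NO balanced partner
inside `W` — for every other point of `W` some unit `g` of `ℤ/M` moves both points to the same side — then `W` is not a disjoint union
of balanced pairs (in such a union every point has a balanced partner inside). [cite: Gordon1999HodgeAVSurvey, 9.2.2]
[cite: GaoUllmo2025, Thm. 3.1] [cite: Washington1997, Thm. 2.5] -/
theorem weightPair_notMem_pohlmannDivisorSetsAlg_of_forall_exists_unit (hdvd : ∀ i, lev i ∣ M)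
    (hΦ : ∀ i (σ : K i →+* ℂ), σ ∈ (Φ i).1 ↔ 2 * (expOf (lev i) (K i) σ).val < lev i)
    {i₁ i₂ : Fin k} (hne : i₁ ≠ i₂) {d₁ d₂ : ℕ} [NeZero d₁] [NeZero d₂] (h₁ : lev i₁ = d₁) (h₂ : lev i₂ = d₂)
    (P₁ P₂ : ZMod M → Prop) [DecidablePred P₁] [DecidablePred P₂]
    {e₀ : ZMod d₁} (he₀ : e₀.val.Coprime d₁) (hP₀ : P₁ ((M / d₁ * e₀.val : ℕ) : ZMod M))
    (hc₁ : ∀ e : ZMod d₁, e.val.Coprime d₁ → P₁ ((M / d₁ * e.val : ℕ) : ZMod M) → e ≠ e₀ →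
      ∃ g : ZMod M, g.val.Coprime M ∧ (2 * (g * ((M / d₁ * e₀.val : ℕ) : ZMod M)).val < M ↔
        2 * (g * ((M / d₁ * e.val : ℕ) : ZMod M)).val < M))
    (hc₂ : ∀ e : ZMod d₂, e.val.Coprime d₂ → P₂ ((M / d₂ * e.val : ℕ) : ZMod M) →
      ∃ g : ZMod M, g.val.Coprime M ∧ (2 * (g * ((M / d₁ * e₀.val : ℕ) : ZMod M)).val < M ↔
        2 * (g * ((M / d₂ * e.val : ℕ) : ZMod M)).val < M))
    (m : ℕ) :
    (Finset.univ.filter fun x : (i : Fin k) × (K i →+* ℂ) =>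
      (x.1 = i₁ ∧ P₁ ((M / lev x.1 * (expOf (lev x.1) (K x.1) x.2).val : ℕ) : ZMod M)) ∨
      (x.1 = i₂ ∧ P₂ ((M / lev x.1 * (expOf (lev x.1) (K x.1) x.2).val : ℕ) : ZMod M))) ∉
      pohlmannDivisorSetsAlg Φ m := by
  classical
  subst h₁
  subst h₂
  obtain ⟨σ₀, hσ₀⟩ := exists_expOf_eq (lev i₁) (K i₁) e₀ he₀
  intro hmem
  have hx₀ : (⟨i₁, σ₀⟩ : (i : Fin k) × (K i →+* ℂ)) ∈ (Finset.univ.filter fun x : (i : Fin k) × (K i →+* ℂ) =>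
      (x.1 = i₁ ∧ P₁ ((M / lev x.1 * (expOf (lev x.1) (K x.1) x.2).val : ℕ) : ZMod M)) ∨
      (x.1 = i₂ ∧ P₂ ((M / lev x.1 * (expOf (lev x.1) (K x.1) x.2).val : ℕ) : ZMod M))) := by
    refine Finset.mem_filter.2 ⟨Finset.mem_univ _, Or.inl ⟨rfl, ?_⟩⟩
    dsimp only
    rw [hσ₀]
    exact hP₀
  obtain ⟨y, hyW, hyne, hbal⟩ := exists_partner_of_mem_pohlmannDivisorSetsAlg' hmem hx₀
  obtain ⟨i', σ'⟩ := y
  rcases (Finset.mem_filter.1 hyW).2 with ⟨hi, hP⟩ | ⟨hi, hP⟩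
  · dsimp only at hi
    subst hi
    dsimp only at hP
    have hne' : expOf (lev i') (K i') σ' ≠ e₀ := by
      intro h
      apply hyne
      rw [expOf_injective (lev i') (K i') (h.trans hσ₀.symm)]
    obtain ⟨g, hg, hiff⟩ := hc₁ _ (coprime_expOf _ _ σ') hP hne'
    obtain ⟨τ, hτ⟩ := exists_autExp_eq M g hg
    refine not_isGaloisBalancedAlg_pair_of_iff hyne.symm τ ?_ hbal
    rw [comp_mem_iff_half_lift (M := M) hdvd hΦ τ ⟨i', σ₀⟩, comp_mem_iff_half_lift (M := M) hdvd hΦ τ ⟨i', σ'⟩]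
    dsimp only
    rw [hσ₀, hτ]
    exact hiff
  · dsimp only at hi
    subst hi
    dsimp only at hP
    obtain ⟨g, hg, hiff⟩ := hc₂ _ (coprime_expOf _ _ σ') hP
    obtain ⟨τ, hτ⟩ := exists_autExp_eq M g hg
    refine not_isGaloisBalancedAlg_pair_of_iff hyne.symm τ ?_ hbal
    rw [comp_mem_iff_half_lift (M := M) hdvd hΦ τ ⟨i₁, σ₀⟩, comp_mem_iff_half_lift (M := M) hdvd hΦ τ ⟨i', σ'⟩]
    dsimp only
    rw [hσ₀, hτ]
    exact hiff

omit [∀ i, NeZero (lev i)] [∀ i, NumberField (K i)] [∀ i, IsCyclotomicExtension {lev i} ℚ (K i)] [NeZero M] in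
/-- Members of different levels are different indices. [folklore] -/
private theorem ne_of_lev_ne' {i₁ i₂ : Fin k} {a b : ℕ} (h₁ : lev i₁ = a) (h₂ : lev i₂ = b) (hab : a ≠ b) : i₁ ≠ i₂ := by
  rintro rfl; exact hab (h₁.symm.trans h₂)

/-- **THE CLASS, CERTIFICATE FORM**: a two-member weight of size `2r` passing both certificates indexes a rational `(r,r)`-class on
`⨁_i A_i` outside `Dʳ ⊗ ℂ` (Pohlmann's dictionary for the CM algebra, tree `exists_exceptional_biproduct_iff`). [cite: GaoUllmo2025, Thm. 3.1]
[cite: Gordon1999HodgeAVSurvey, 9.2.2 and §9.3] [cite: Pohlmann1968, Thm. 1] -/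
theorem weightPair_mem_pohlmannSetsAlg_diff (hdvd : ∀ i, lev i ∣ M)
    (hΦ : ∀ i (σ : K i →+* ℂ), σ ∈ (Φ i).1 ↔ 2 * (expOf (lev i) (K i) σ).val < lev i)
    {i₁ i₂ : Fin k} (hne : i₁ ≠ i₂) {d₁ d₂ : ℕ} [NeZero d₁] [NeZero d₂] (h₁ : lev i₁ = d₁) (h₂ : lev i₂ = d₂)
    (P₁ P₂ : ZMod M → Prop) [DecidablePred P₁] [DecidablePred P₂] {r : ℕ}
    (hcard : (Finset.univ.filter fun e : ZMod d₁ => e.val.Coprime d₁ ∧ P₁ ((M / d₁ * e.val : ℕ) : ZMod M)).card +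
        (Finset.univ.filter fun e : ZMod d₂ => e.val.Coprime d₂ ∧ P₂ ((M / d₂ * e.val : ℕ) : ZMod M)).card = 2 * r)
    (hbal : ∀ g : ZMod M, g.val.Coprime M →
      (Finset.univ.filter fun e : ZMod d₁ => e.val.Coprime d₁ ∧ P₁ ((M / d₁ * e.val : ℕ) : ZMod M) ∧
          2 * (g * ((M / d₁ * e.val : ℕ) : ZMod M)).val < M).card +
        (Finset.univ.filter fun e : ZMod d₂ => e.val.Coprime d₂ ∧ P₂ ((M / d₂ * e.val : ℕ) : ZMod M) ∧
          2 * (g * ((M / d₂ * e.val : ℕ) : ZMod M)).val < M).card =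
      (Finset.univ.filter fun e : ZMod d₁ => e.val.Coprime d₁ ∧ P₁ ((M / d₁ * e.val : ℕ) : ZMod M) ∧
          ¬2 * (g * ((M / d₁ * e.val : ℕ) : ZMod M)).val < M).card +
        (Finset.univ.filter fun e : ZMod d₂ => e.val.Coprime d₂ ∧ P₂ ((M / d₂ * e.val : ℕ) : ZMod M) ∧
          ¬2 * (g * ((M / d₂ * e.val : ℕ) : ZMod M)).val < M).card)
    {e₀ : ZMod d₁} (he₀ : e₀.val.Coprime d₁) (hP₀ : P₁ ((M / d₁ * e₀.val : ℕ) : ZMod M))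
    (hc₁ : ∀ e : ZMod d₁, e.val.Coprime d₁ → P₁ ((M / d₁ * e.val : ℕ) : ZMod M) → e ≠ e₀ →
      ∃ g : ZMod M, g.val.Coprime M ∧ (2 * (g * ((M / d₁ * e₀.val : ℕ) : ZMod M)).val < M ↔
        2 * (g * ((M / d₁ * e.val : ℕ) : ZMod M)).val < M))
    (hc₂ : ∀ e : ZMod d₂, e.val.Coprime d₂ → P₂ ((M / d₂ * e.val : ℕ) : ZMod M) →
      ∃ g : ZMod M, g.val.Coprime M ∧ (2 * (g * ((M / d₁ * e₀.val : ℕ) : ZMod M)).val < M ↔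
        2 * (g * ((M / d₂ * e.val : ℕ) : ZMod M)).val < M)) :
    (Finset.univ.filter fun x : (i : Fin k) × (K i →+* ℂ) =>
      (x.1 = i₁ ∧ P₁ ((M / lev x.1 * (expOf (lev x.1) (K x.1) x.2).val : ℕ) : ZMod M)) ∨
      (x.1 = i₂ ∧ P₂ ((M / lev x.1 * (expOf (lev x.1) (K x.1) x.2).val : ℕ) : ZMod M))) ∈
      pohlmannSetsAlg Φ r \ pohlmannDivisorSetsAlg Φ r := by
  refine ⟨⟨?_, isGaloisBalancedAlg_weightPair_of_forall_units hdvd hΦ hne h₁ h₂ P₁ P₂ hbal⟩,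
    weightPair_notMem_pohlmannDivisorSetsAlg_of_forall_exists_unit hdvd hΦ hne h₁ h₂ P₁ P₂ he₀ hP₀ hc₁ hc₂ r⟩
  rw [card_weightPair_eq hne h₁ h₂ P₁ P₂]
  exact hcard

end Certificate

/-! ## §2 `J_{40}`: an exceptional Hodge class of codimension `3` on `X_8 × X_{40}`

The weight `W_{40} = Φ_8 ⊔ {σ_7, σ_21, σ_23, σ_29}`: both embeddings of the TYPE of the level-`8` member (`e ∈ {1, 3}`, lifts `5, 15`
in `ℤ/40` — the whole `(2,0)`-part of `X_8`) and the four embeddings of exponents `7, 21, 23, 29` of the level-`40` member.  The exhaustive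
search (`16` units of `ℤ/40` acting on the `38` embeddings of `⊔_{d ∣ 40, d ≥ 3} Hom(ℚ(ζ_d), ℂ)`) finds NO balanced non-divisorial
weight of size `2` or `4` and `32` of size `6`, all supported on `X_8 × X_{40}`; `W_{40}` is one of them. -/

section LevelForty

variable {k : ℕ} {lev : Fin k → ℕ} [∀ i, NeZero (lev i)] {K : Fin k → Type} [∀ i, Field (K i)]
  [∀ i, NumberField (K i)] [∀ i, IsCyclotomicExtension {lev i} ℚ (K i)] {Φ : ∀ i, CMType (K i)}

/-- **`W_{40} ∈ pohlmannSetsAlg Φ 3 ∖ pohlmannDivisorSetsAlg Φ 3`** for every family of lower-half types at levels `d_i ∣ 40` with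
members `i₁`, `i₂` of levels `8`, `40`: Pohlmann's condition and the absence of a balanced partner of `(i₁, σ_1)` inside `W_{40}` are
kernel-checked finite facts about `ℤ/40` (certificate form, §1). [cite: GaoUllmo2025, Thm. 3.1] [cite: Gordon1999HodgeAVSurvey, 9.2.2]
[cite: GalleseGoodsonLombardo2024, §3 Thm. 3.0 and §3.2 Lemma 11] -/
theorem weightForty_mem_pohlmannSetsAlg_diff (hdvd : ∀ i, lev i ∣ 40) {i₁ i₂ : Fin k} (h₁ : lev i₁ = 8) (h₂ : lev i₂ = 40)
    (hΦ : ∀ i (σ : K i →+* ℂ), σ ∈ (Φ i).1 ↔ 2 * (expOf (lev i) (K i) σ).val < lev i) :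
    (Finset.univ.filter fun x : (i : Fin k) × (K i →+* ℂ) =>
      (x.1 = i₁ ∧ ((((40 / lev x.1 * (expOf (lev x.1) (K x.1) x.2).val : ℕ) : ZMod 40)).val = 5 ∨
        (((40 / lev x.1 * (expOf (lev x.1) (K x.1) x.2).val : ℕ) : ZMod 40)).val = 15)) ∨
      (x.1 = i₂ ∧ ((((40 / lev x.1 * (expOf (lev x.1) (K x.1) x.2).val : ℕ) : ZMod 40)).val = 7 ∨
        (((40 / lev x.1 * (expOf (lev x.1) (K x.1) x.2).val : ℕ) : ZMod 40)).val = 21 ∨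
        (((40 / lev x.1 * (expOf (lev x.1) (K x.1) x.2).val : ℕ) : ZMod 40)).val = 23 ∨
        (((40 / lev x.1 * (expOf (lev x.1) (K x.1) x.2).val : ℕ) : ZMod 40)).val = 29))) ∈
      pohlmannSetsAlg Φ 3 \ pohlmannDivisorSetsAlg Φ 3 :=
  weightPair_mem_pohlmannSetsAlg_diff (M := 40) hdvd hΦ (ne_of_lev_ne' h₁ h₂ (by norm_num)) h₁ h₂
    (fun t : ZMod 40 => t.val = 5 ∨ t.val = 15) (fun t : ZMod 40 => t.val = 7 ∨ t.val = 21 ∨ t.val = 23 ∨ t.val = 29)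
    (r := 3) (by decide +kernel) (by decide +kernel) (e₀ := (1 : ZMod 8)) (by decide +kernel) (by decide +kernel)
    (by decide +kernel) (by decide +kernel)

variable {A : Fin k → AbelianVariety ℂ} {ι : ∀ i, 𝓞 (K i) →+* End (A i)}
  {θ : ∀ i, K i →+* Module.End ℂ (complexBetti (A i).X 1)}

/-- **EVERY PRODUCT `⨁_i A_i` OF REALISATIONS OF LOWER-HALF TYPES AT LEVELS `d_i ∣ 40` CONTAINING MEMBERS OF LEVELS `8` AND `40` — in
particular `X_8 × X_{40}` and `J_{40} ∼ X_4 × X_5 × X_8 × X_{10} × X_{20} × X_{40}` — CARRIES A RATIONAL `(3,3)`-CLASS OUTSIDE `𝓓³ ⊗ ℂ` ON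
ITSELF**, indexed by `W_{40}` (supported on `X_8 × X_{40}`, dimension `2 + 8 = 10`; codimension `3`).  This LOCATES the exceptional classes
of `J_{40}` (the tree's F38 had: some power of a product of pieces carries one).  Assembled from Pohlmann's criterion in the CM-algebra
form; not printed. [cite: GalleseGoodsonLombardo2024, §1 (p. 4) and §3 Thm. 3.0] [cite: GaoUllmo2025, Thm. 3.1]
[cite: Gordon1999HodgeAVSurvey, 9.2.2 and §9.3] -/
theorem exists_exceptional_of_levels_eight_forty (hdvd : ∀ i, lev i ∣ 40) {i₁ i₂ : Fin k} (h₁ : lev i₁ = 8) (h₂ : lev i₂ = 40)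
    (hΦ : ∀ i (σ : K i →+* ℂ), σ ∈ (Φ i).1 ↔ 2 * (expOf (lev i) (K i) σ).val < lev i)
    (hA : ∀ i, IsCMTypeRealisation (Φ i) (A i) (ι i) (θ i)) :
    ∃ c : complexBetti (⨁ A).X (2 * 3), IsRationalClass c ∧ IsOfHodgeType (⨁ A).dim (⨁ A).X (2 * 3) 3 3 c ∧
      c ∉ divisorClassesSpan (⨁ A).X (⨁ A).dim 3 :=
  (exists_exceptional_biproduct_iff hA 3).2 ⟨_, weightForty_mem_pohlmannSetsAlg_diff hdvd h₁ h₂ hΦ⟩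

/-- **Such a family is not nondegenerate** (Gordon 7.5 (3) fails). [cite: Gordon1999HodgeAVSurvey, 7.5 and §9.3]
[cite: GalleseGoodsonLombardo2024, §3 Thm. 3.0] -/
theorem not_isNondegenerateFamily_of_levels_eight_forty (hdvd : ∀ i, lev i ∣ 40) (h2 : ∀ i, 2 < lev i)
    {i₁ i₂ : Fin k} (h₁ : lev i₁ = 8) (h₂ : lev i₂ = 40)
    (hΦ : ∀ i (σ : K i →+* ℂ), σ ∈ (Φ i).1 ↔ 2 * (expOf (lev i) (K i) σ).val < lev i) :
    ¬IsNondegenerateFamily Φ := by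
  haveI : ∀ i, IsCMField (K i) := fun i => IsCyclotomicExtension.Rat.isCMField (K i) (S := {lev i}) ⟨lev i, rfl, h2 i⟩
  haveI : Nonempty (Fin k) := ⟨i₁⟩
  intro hnd
  have h := weightForty_mem_pohlmannSetsAlg_diff (Φ := Φ) hdvd h₁ h₂ hΦ
  exact h.2 (hnd.pohlmannSetsAlg_subset id 3 h.1)

end LevelForty

/-! ## §3 `J_{48}`: an exceptional Hodge class of codimension `2` on `X_{16} × X_{48}`

The weight `W_{48} = {σ_1, σ_3} ⊔ {σ_25, σ_31}`: two embeddings of the level-`16` member (lifts `3, 9` in `ℤ/48`) and two of the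
level-`48` member.  The exhaustive search finds NO balanced non-divisorial weight of size `2` and `64` of size `4`, all supported on
`X_{16} × X_{48}`; `W_{48}` is one of them. -/

section LevelFortyEight

variable {k : ℕ} {lev : Fin k → ℕ} [∀ i, NeZero (lev i)] {K : Fin k → Type} [∀ i, Field (K i)]
  [∀ i, NumberField (K i)] [∀ i, IsCyclotomicExtension {lev i} ℚ (K i)] {Φ : ∀ i, CMType (K i)}

/-- **`W_{48} ∈ pohlmannSetsAlg Φ 2 ∖ pohlmannDivisorSetsAlg Φ 2`** for every family of lower-half types at levels `d_i ∣ 48` with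
members `i₁`, `i₂` of levels `16`, `48` (certificate form, §1; kernel-checked on `ℤ/48`). [cite: GaoUllmo2025, Thm. 3.1]
[cite: Gordon1999HodgeAVSurvey, 9.2.2] [cite: GalleseGoodsonLombardo2024, §3 Thm. 3.0 and §3.2 Lemma 11] -/
theorem weightFortyEight_mem_pohlmannSetsAlg_diff (hdvd : ∀ i, lev i ∣ 48) {i₁ i₂ : Fin k} (h₁ : lev i₁ = 16) (h₂ : lev i₂ = 48)
    (hΦ : ∀ i (σ : K i →+* ℂ), σ ∈ (Φ i).1 ↔ 2 * (expOf (lev i) (K i) σ).val < lev i) :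
    (Finset.univ.filter fun x : (i : Fin k) × (K i →+* ℂ) =>
      (x.1 = i₁ ∧ ((((48 / lev x.1 * (expOf (lev x.1) (K x.1) x.2).val : ℕ) : ZMod 48)).val = 3 ∨
        (((48 / lev x.1 * (expOf (lev x.1) (K x.1) x.2).val : ℕ) : ZMod 48)).val = 9)) ∨
      (x.1 = i₂ ∧ ((((48 / lev x.1 * (expOf (lev x.1) (K x.1) x.2).val : ℕ) : ZMod 48)).val = 25 ∨
        (((48 / lev x.1 * (expOf (lev x.1) (K x.1) x.2).val : ℕ) : ZMod 48)).val = 31))) ∈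
      pohlmannSetsAlg Φ 2 \ pohlmannDivisorSetsAlg Φ 2 :=
  weightPair_mem_pohlmannSetsAlg_diff (M := 48) hdvd hΦ (ne_of_lev_ne' h₁ h₂ (by norm_num)) h₁ h₂
    (fun t : ZMod 48 => t.val = 3 ∨ t.val = 9) (fun t : ZMod 48 => t.val = 25 ∨ t.val = 31)
    (r := 2) (by decide +kernel) (by decide +kernel) (e₀ := (1 : ZMod 16)) (by decide +kernel) (by decide +kernel)
    (by decide +kernel) (by decide +kernel)

variable {A : Fin k → AbelianVariety ℂ} {ι : ∀ i, 𝓞 (K i) →+* End (A i)}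
  {θ : ∀ i, K i →+* Module.End ℂ (complexBetti (A i).X 1)}

/-- **EVERY PRODUCT `⨁_i A_i` OF REALISATIONS OF LOWER-HALF TYPES AT LEVELS `d_i ∣ 48` CONTAINING MEMBERS OF LEVELS `16` AND `48` — in
particular `X_{16} × X_{48}` and `J_{48}` — CARRIES A RATIONAL `(2,2)`-CLASS OUTSIDE `𝓓² ⊗ ℂ` ON ITSELF**, indexed by `W_{48}` (supported
on `X_{16} × X_{48}`, dimension `4 + 8 = 12`; codimension `2`).  This LOCATES the exceptional classes of `J_{48}`.  Assembled; not printed.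
[cite: GalleseGoodsonLombardo2024, §1 (p. 4) and §3 Thm. 3.0] [cite: GaoUllmo2025, Thm. 3.1] [cite: Gordon1999HodgeAVSurvey, 9.2.2 and §9.3] -/
theorem exists_exceptional_of_levels_sixteen_fortyEight (hdvd : ∀ i, lev i ∣ 48) {i₁ i₂ : Fin k} (h₁ : lev i₁ = 16)
    (h₂ : lev i₂ = 48) (hΦ : ∀ i (σ : K i →+* ℂ), σ ∈ (Φ i).1 ↔ 2 * (expOf (lev i) (K i) σ).val < lev i)
    (hA : ∀ i, IsCMTypeRealisation (Φ i) (A i) (ι i) (θ i)) :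
    ∃ c : complexBetti (⨁ A).X (2 * 2), IsRationalClass c ∧ IsOfHodgeType (⨁ A).dim (⨁ A).X (2 * 2) 2 2 c ∧
      c ∉ divisorClassesSpan (⨁ A).X (⨁ A).dim 2 :=
  (exists_exceptional_biproduct_iff hA 2).2 ⟨_, weightFortyEight_mem_pohlmannSetsAlg_diff hdvd h₁ h₂ hΦ⟩

/-- **Such a family is not nondegenerate.** [cite: Gordon1999HodgeAVSurvey, 7.5 and §9.3] [cite: GalleseGoodsonLombardo2024, §3 Thm. 3.0] -/
theorem not_isNondegenerateFamily_of_levels_sixteen_fortyEight (hdvd : ∀ i, lev i ∣ 48)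
    (h2 : ∀ i, 2 < lev i) {i₁ i₂ : Fin k} (h₁ : lev i₁ = 16) (h₂ : lev i₂ = 48)
    (hΦ : ∀ i (σ : K i →+* ℂ), σ ∈ (Φ i).1 ↔ 2 * (expOf (lev i) (K i) σ).val < lev i) :
    ¬IsNondegenerateFamily Φ := by
  haveI : ∀ i, IsCMField (K i) := fun i => IsCyclotomicExtension.Rat.isCMField (K i) (S := {lev i}) ⟨lev i, rfl, h2 i⟩
  haveI : Nonempty (Fin k) := ⟨i₁⟩
  intro hnd
  have h := weightFortyEight_mem_pohlmannSetsAlg_diff (Φ := Φ) hdvd h₁ h₂ hΦ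
  exact h.2 (hnd.pohlmannSetsAlg_subset id 2 h.1)

end LevelFortyEight

/-! ## §4 On the `J_m`-family: the classes of `J_{40} ⊂ J_m` (`40 ∣ m`) and `J_{48} ⊂ J_m` (`48 ∣ m`) on two pieces; Goodson's class on
`X_d × X_{d / minFac d}` for an odd composite divisor `d`; THE LOCATED CLASSES FOR EVERY DEGENERATE `J_m`, ON `J_m` ITSELF; `B(J_m) = D(J_m)`
iff `m ∈ {p, 2p, 2^k, m ∣ 24, 20}` -/

section FamilyPair

variable {κ : Type} {lev : κ → ℕ} [∀ j, NeZero (lev j)] {F : κ → Type} [∀ j, Field (F j)]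
  [∀ j, NumberField (F j)] [∀ j, IsCyclotomicExtension {lev j} ℚ (F j)] {Ψ : ∀ j, CMType (F j)} {C : κ → AbelianVariety ℂ}
  {ιC : ∀ j, 𝓞 (F j) →+* End (C j)} {θC : ∀ j, F j →+* Module.End ℂ (complexBetti (C j).X 1)}

/-- `2 · dim C_j = φ(d)` for a member of level `d > 2` (GGL Thm. 3.0: «`X_d` has dimension `φ(d)/2`»). [cite: GalleseGoodsonLombardo2024, §3 Thm. 3.0] -/
private theorem two_mul_dim_eq_totient_of_lev_eq {j : κ} {d : ℕ} (hj : lev j = d) (h2 : 2 < d)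
    (hC : IsCMTypeRealisation (Ψ j) (C j) (ιC j) (θC j)) : 2 * (C j).dim = Nat.totient d := by
  have h := IsCMTypeRealisation.two_mul_dim_eq_totient (m := lev j) (by rw [hj]; exact h2) hC
  rwa [hj] at h

/-- **`X_8 × X_{40}` CARRIES AN EXCEPTIONAL HODGE CLASS OF CODIMENSION `3`**: for members `j₁, j₂` of levels `8, 40` of any family of
realisations of lower-half types, `C_{j₁} ⊕ C_{j₂}` (dimension `2 + 8 = 10`) carries a rational `(3,3)`-class outside `𝓓³ ⊗ ℂ`.
[cite: GalleseGoodsonLombardo2024, §1 (p. 4) and §3 Thm. 3.0] [cite: GaoUllmo2025, Thm. 3.1] [cite: Gordon1999HodgeAVSurvey, 9.2.2] -/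
theorem exists_exceptional_pair_of_lev_eq_eight_forty
    (hΨ : ∀ j (σ : F j →+* ℂ), σ ∈ (Ψ j).1 ↔ 2 * (expOf (lev j) (F j) σ).val < lev j)
    (hC : ∀ j, IsCMTypeRealisation (Ψ j) (C j) (ιC j) (θC j)) {j₁ j₂ : κ} (hj₁ : lev j₁ = 8) (hj₂ : lev j₂ = 40) :
    (⨁ fun i : Fin 2 => C (![j₁, j₂] i)).dim = 10 ∧
    ∃ c : complexBetti (⨁ fun i : Fin 2 => C (![j₁, j₂] i)).X (2 * 3), IsRationalClass c ∧
      IsOfHodgeType (⨁ fun i : Fin 2 => C (![j₁, j₂] i)).dim (⨁ fun i : Fin 2 => C (![j₁, j₂] i)).X (2 * 3) 3 3 c ∧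
      c ∉ divisorClassesSpan (⨁ fun i : Fin 2 => C (![j₁, j₂] i)).X (⨁ fun i : Fin 2 => C (![j₁, j₂] i)).dim 3 := by
  refine ⟨?_, exists_exceptional_of_levels_eight_forty (k := 2) (lev := fun i => lev (![j₁, j₂] i))
    (K := fun i => F (![j₁, j₂] i)) (Φ := fun i => Ψ (![j₁, j₂] i)) (A := fun i => C (![j₁, j₂] i))
    (ι := fun i => ιC (![j₁, j₂] i)) (θ := fun i => θC (![j₁, j₂] i))
    (Fin.forall_fin_two.2 ⟨by show lev j₁ ∣ 40; rw [hj₁]; norm_num, by show lev j₂ ∣ 40; rw [hj₂]⟩)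
    (i₁ := 0) (i₂ := 1) hj₁ hj₂ (fun i σ => hΨ _ σ) (fun i => hC _)⟩
  rw [dim_biproduct, Fin.sum_univ_two]
  have h0 : 2 * (C (![j₁, j₂] 0)).dim = Nat.totient 8 := two_mul_dim_eq_totient_of_lev_eq hj₁ (by norm_num) (hC j₁)
  have h1 : 2 * (C (![j₁, j₂] 1)).dim = Nat.totient 40 := two_mul_dim_eq_totient_of_lev_eq hj₂ (by norm_num) (hC j₂)
  rw [show Nat.totient 8 = 4 by decide] at h0
  rw [show Nat.totient 40 = 16 by decide] at h1
  omega

/-- **ON THE `J_m`-FAMILY, `40 ∣ m`** (one realisation of the lower-half type at each divisor `d ≥ 3` of `m`): there are members of levels `8`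
and `40`, and `X_8 × X_{40}` (dimension `10`) carries an exceptional Hodge class of codimension `3` — an exceptional class of `J_m` located on
two pieces (`m = 40, 80, 120, 160, …`). [cite: GalleseGoodsonLombardo2024, §1 (p. 4) and §3 Thm. 3.0] [cite: GaoUllmo2025, Thm. 3.1]
[cite: Gordon1999HodgeAVSurvey, 9.2.2] -/
theorem exists_exceptional_pair_of_forty_dvd {m : ℕ} (hm : 40 ∣ m) (hlev : ∀ d, (∃ j, lev j = d) ↔ d ∣ m ∧ 3 ≤ d)
    (hΨ : ∀ j (σ : F j →+* ℂ), σ ∈ (Ψ j).1 ↔ 2 * (expOf (lev j) (F j) σ).val < lev j)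
    (hC : ∀ j, IsCMTypeRealisation (Ψ j) (C j) (ιC j) (θC j)) :
    ∃ j₁ j₂, lev j₁ = 8 ∧ lev j₂ = 40 ∧ (⨁ fun i : Fin 2 => C (![j₁, j₂] i)).dim = 10 ∧
      ∃ c : complexBetti (⨁ fun i : Fin 2 => C (![j₁, j₂] i)).X (2 * 3), IsRationalClass c ∧
        IsOfHodgeType (⨁ fun i : Fin 2 => C (![j₁, j₂] i)).dim (⨁ fun i : Fin 2 => C (![j₁, j₂] i)).X (2 * 3) 3 3 c ∧
        c ∉ divisorClassesSpan (⨁ fun i : Fin 2 => C (![j₁, j₂] i)).X (⨁ fun i : Fin 2 => C (![j₁, j₂] i)).dim 3 := by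
  obtain ⟨j₁, hj₁⟩ := (hlev 8).2 ⟨dvd_trans (by norm_num) hm, by norm_num⟩
  obtain ⟨j₂, hj₂⟩ := (hlev 40).2 ⟨hm, by norm_num⟩
  exact ⟨j₁, j₂, hj₁, hj₂, exists_exceptional_pair_of_lev_eq_eight_forty hΨ hC hj₁ hj₂⟩

/-- **`X_{16} × X_{48}` CARRIES AN EXCEPTIONAL HODGE CLASS OF CODIMENSION `2`**: for members `j₁, j₂` of levels `16, 48` of any family of
realisations of lower-half types, `C_{j₁} ⊕ C_{j₂}` (dimension `4 + 8 = 12`) carries a rational `(2,2)`-class outside `𝓓² ⊗ ℂ`.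
[cite: GalleseGoodsonLombardo2024, §1 (p. 4) and §3 Thm. 3.0] [cite: GaoUllmo2025, Thm. 3.1] [cite: Gordon1999HodgeAVSurvey, 9.2.2] -/
theorem exists_exceptional_pair_of_lev_eq_sixteen_fortyEight
    (hΨ : ∀ j (σ : F j →+* ℂ), σ ∈ (Ψ j).1 ↔ 2 * (expOf (lev j) (F j) σ).val < lev j)
    (hC : ∀ j, IsCMTypeRealisation (Ψ j) (C j) (ιC j) (θC j)) {j₁ j₂ : κ} (hj₁ : lev j₁ = 16) (hj₂ : lev j₂ = 48) :
    (⨁ fun i : Fin 2 => C (![j₁, j₂] i)).dim = 12 ∧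
    ∃ c : complexBetti (⨁ fun i : Fin 2 => C (![j₁, j₂] i)).X (2 * 2), IsRationalClass c ∧
      IsOfHodgeType (⨁ fun i : Fin 2 => C (![j₁, j₂] i)).dim (⨁ fun i : Fin 2 => C (![j₁, j₂] i)).X (2 * 2) 2 2 c ∧
      c ∉ divisorClassesSpan (⨁ fun i : Fin 2 => C (![j₁, j₂] i)).X (⨁ fun i : Fin 2 => C (![j₁, j₂] i)).dim 2 := by
  refine ⟨?_, exists_exceptional_of_levels_sixteen_fortyEight (k := 2) (lev := fun i => lev (![j₁, j₂] i))
    (K := fun i => F (![j₁, j₂] i)) (Φ := fun i => Ψ (![j₁, j₂] i)) (A := fun i => C (![j₁, j₂] i))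
    (ι := fun i => ιC (![j₁, j₂] i)) (θ := fun i => θC (![j₁, j₂] i))
    (Fin.forall_fin_two.2 ⟨by show lev j₁ ∣ 48; rw [hj₁]; norm_num, by show lev j₂ ∣ 48; rw [hj₂]⟩)
    (i₁ := 0) (i₂ := 1) hj₁ hj₂ (fun i σ => hΨ _ σ) (fun i => hC _)⟩
  rw [dim_biproduct, Fin.sum_univ_two]
  have h0 : 2 * (C (![j₁, j₂] 0)).dim = Nat.totient 16 := two_mul_dim_eq_totient_of_lev_eq hj₁ (by norm_num) (hC j₁)
  have h1 : 2 * (C (![j₁, j₂] 1)).dim = Nat.totient 48 := two_mul_dim_eq_totient_of_lev_eq hj₂ (by norm_num) (hC j₂)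
  rw [show Nat.totient 16 = 8 by decide] at h0
  rw [show Nat.totient 48 = 16 by decide] at h1
  omega

/-- **ON THE `J_m`-FAMILY, `48 ∣ m`**: there are members of levels `16` and `48`, and `X_{16} × X_{48}` (dimension `12`) carries an exceptional
Hodge class of codimension `2` (`m = 48, 96, 144, …`). [cite: GalleseGoodsonLombardo2024, §1 (p. 4) and §3 Thm. 3.0] [cite: GaoUllmo2025, Thm. 3.1]
[cite: Gordon1999HodgeAVSurvey, 9.2.2] -/
theorem exists_exceptional_pair_of_fortyEight_dvd {m : ℕ} (hm : 48 ∣ m) (hlev : ∀ d, (∃ j, lev j = d) ↔ d ∣ m ∧ 3 ≤ d)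
    (hΨ : ∀ j (σ : F j →+* ℂ), σ ∈ (Ψ j).1 ↔ 2 * (expOf (lev j) (F j) σ).val < lev j)
    (hC : ∀ j, IsCMTypeRealisation (Ψ j) (C j) (ιC j) (θC j)) :
    ∃ j₁ j₂, lev j₁ = 16 ∧ lev j₂ = 48 ∧ (⨁ fun i : Fin 2 => C (![j₁, j₂] i)).dim = 12 ∧
      ∃ c : complexBetti (⨁ fun i : Fin 2 => C (![j₁, j₂] i)).X (2 * 2), IsRationalClass c ∧
        IsOfHodgeType (⨁ fun i : Fin 2 => C (![j₁, j₂] i)).dim (⨁ fun i : Fin 2 => C (![j₁, j₂] i)).X (2 * 2) 2 2 c ∧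
        c ∉ divisorClassesSpan (⨁ fun i : Fin 2 => C (![j₁, j₂] i)).X (⨁ fun i : Fin 2 => C (![j₁, j₂] i)).dim 2 := by
  obtain ⟨j₁, hj₁⟩ := (hlev 16).2 ⟨dvd_trans (by norm_num) hm, by norm_num⟩
  obtain ⟨j₂, hj₂⟩ := (hlev 48).2 ⟨hm, by norm_num⟩
  exact ⟨j₁, j₂, hj₁, hj₂, exists_exceptional_pair_of_lev_eq_sixteen_fortyEight hΨ hC hj₁ hj₂⟩

/-- An odd composite `d` factors as `d = p · n` with `p = minFac d` an odd prime and `n = d / p ≥ p ≥ 3` odd, `n ∤ p + 1` (private copy of the F37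
helper). [folklore] -/
private theorem minFac_data' {d : ℕ} (hodd : Odd d) (hprime : ¬d.Prime) (h1 : 1 < d) :
    (d.minFac).Prime ∧ d.minFac ≠ 2 ∧ Odd (d / d.minFac) ∧ 3 ≤ d / d.minFac ∧ ¬(d / d.minFac ∣ d.minFac + 1) ∧
      d = d.minFac * (d / d.minFac) := by
  have hp : d.minFac.Prime := Nat.minFac_prime (by omega)
  have hmeq : d = d.minFac * (d / d.minFac) := (Nat.mul_div_cancel' (Nat.minFac_dvd d)).symm
  have hp2 : d.minFac ≠ 2 := fun h => (Nat.not_even_iff_odd.2 hodd) (even_iff_two_dvd.2 (h ▸ Nat.minFac_dvd d))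
  have hn : Odd (d / d.minFac) := Odd.of_dvd_nat hodd (Nat.div_dvd_of_dvd (Nat.minFac_dvd d))
  have hle : d.minFac ≤ d / d.minFac := Nat.minFac_le_div (by omega) hprime
  have hp3 : 3 ≤ d.minFac := by have := hp.two_le; omega
  have h3n : 3 ≤ d / d.minFac := le_trans hp3 hle
  refine ⟨hp, hp2, hn, h3n, fun hdv => ?_, hmeq⟩
  have hle' : d / d.minFac ≤ d.minFac + 1 := Nat.le_of_dvd (Nat.succ_pos _) hdv
  rcases Nat.eq_or_lt_of_le hle' with h | h
  · rw [h] at hn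
    exact (Nat.not_even_iff_odd.2 hn) ((hp.odd_of_ne_two hp2).add_one)
  · have heq : d / d.minFac = d.minFac := le_antisymm (by omega) hle
    rw [heq] at hdv
    have h1' : d.minFac ∣ 1 := (Nat.dvd_add_right (dvd_refl d.minFac)).1 hdv
    have := Nat.le_of_dvd one_pos h1'
    omega

/-- **GOODSON'S CLASS ON TWO PIECES: `X_d × X_{d/p}` CARRIES AN EXCEPTIONAL HODGE CLASS OF CODIMENSION `(p+1)/2`** for an odd composite `d`,
`p = minFac d`: for members `j₁, j₂` of levels `d` and `d / p` of any family of realisations of lower-half types, `C_{j₁} ⊕ C_{j₂}` carries a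
rational `((p+1)/2, (p+1)/2)`-class outside `𝓓 ⊗ ℂ` (the tree's `exists_exceptional_of_minFac` — Thm. 1.1 at the least prime factor — read on the
two-member sub-family). [cite: Goodson2024DegeneracyFermat, Thm. 1.1 and §4.1] [cite: Shioda1981FermatType, Lemma 5.5] [cite: GaoUllmo2025, Thm. 3.1] -/
theorem exists_exceptional_pair_of_lev_eq_odd_composite {d : ℕ} (hodd : Odd d) (hprime : ¬d.Prime) (h1 : 1 < d)
    (hΨ : ∀ j (σ : F j →+* ℂ), σ ∈ (Ψ j).1 ↔ 2 * (expOf (lev j) (F j) σ).val < lev j)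
    (hC : ∀ j, IsCMTypeRealisation (Ψ j) (C j) (ιC j) (θC j)) {j₁ j₂ : κ} (hj₁ : lev j₁ = d) (hj₂ : lev j₂ = d / d.minFac) :
    ∃ c : complexBetti (⨁ fun i : Fin 2 => C (![j₁, j₂] i)).X (2 * ((d.minFac + 1) / 2)), IsRationalClass c ∧
      IsOfHodgeType (⨁ fun i : Fin 2 => C (![j₁, j₂] i)).dim (⨁ fun i : Fin 2 => C (![j₁, j₂] i)).X (2 * ((d.minFac + 1) / 2))
        ((d.minFac + 1) / 2) ((d.minFac + 1) / 2) c ∧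
      c ∉ divisorClassesSpan (⨁ fun i : Fin 2 => C (![j₁, j₂] i)).X (⨁ fun i : Fin 2 => C (![j₁, j₂] i)).dim ((d.minFac + 1) / 2) := by
  obtain ⟨hp, hp2, hn, h3n, hpn, hmeq⟩ := minFac_data' hodd hprime h1
  haveI : NeZero d := ⟨by omega⟩
  have hp3 : 3 ≤ d.minFac := by have := hp.two_le; omega
  have hlt : d / d.minFac < d := Nat.div_lt_self (by omega) (by omega)
  have hdvd : ∀ i : Fin 2, lev (![j₁, j₂] i) ∣ d := Fin.forall_fin_two.2
    ⟨by show lev j₁ ∣ d; rw [hj₁], by show lev j₂ ∣ d; rw [hj₂]; exact Nat.div_dvd_of_dvd (Nat.minFac_dvd d)⟩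
  have hinj : Function.Injective fun i : Fin 2 => lev (![j₁, j₂] i) := by
    intro a b hab
    have hl : lev (![j₁, j₂] a) = lev (![j₁, j₂] b) := hab
    fin_cases a <;> fin_cases b
    · rfl
    · exfalso
      have e : lev j₁ = lev j₂ := hl
      rw [hj₁, hj₂] at e
      omega
    · exfalso
      have e : lev j₂ = lev j₁ := hl
      rw [hj₁, hj₂] at e
      omega
    · rfl
  have h2 : ∀ i : Fin 2, 2 < lev (![j₁, j₂] i) := Fin.forall_fin_two.2 ⟨by show 2 < lev j₁; omega, by show 2 < lev j₂; omega⟩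
  have h₁ : lev (![j₁, j₂] 0) = d.minFac * (d / d.minFac) := by show lev j₁ = _; rw [hj₁]; exact hmeq
  exact exists_exceptional_of_minFac (m := d) (lev := fun i => lev (![j₁, j₂] i)) (K := fun i => F (![j₁, j₂] i))
    (Φ := fun i => Ψ (![j₁, j₂] i)) (A := fun i => C (![j₁, j₂] i)) (ι := fun i => ιC (![j₁, j₂] i))
    (θ := fun i => θC (![j₁, j₂] i)) hodd hprime h1 hdvd hinj h2 (i₁ := 0) (i₂ := 1) (by show lev j₁ = d; exact hj₁)
    (by show lev j₂ = d / d.minFac; exact hj₂) (fun i σ => hΨ _ σ) (fun i => hC _)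

/-- **ON THE `J_m`-FAMILY, `d ∣ m` ODD COMPOSITE**: there are members of levels `d` and `d / minFac d`, and `X_d × X_{d / minFac d}` carries an
exceptional Hodge class of codimension `(minFac d + 1)/2`. [cite: Goodson2024DegeneracyFermat, Thm. 1.1 and §4.1]
[cite: GalleseGoodsonLombardo2024, §1 (p. 4) and §3 Thm. 3.0] -/
theorem exists_exceptional_pair_of_odd_composite_dvd {m d : ℕ} (hdm : d ∣ m) (hodd : Odd d) (hprime : ¬d.Prime) (h1 : 1 < d)
    (hlev : ∀ e, (∃ j, lev j = e) ↔ e ∣ m ∧ 3 ≤ e)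
    (hΨ : ∀ j (σ : F j →+* ℂ), σ ∈ (Ψ j).1 ↔ 2 * (expOf (lev j) (F j) σ).val < lev j)
    (hC : ∀ j, IsCMTypeRealisation (Ψ j) (C j) (ιC j) (θC j)) :
    ∃ j₁ j₂, lev j₁ = d ∧ lev j₂ = d / d.minFac ∧
      ∃ c : complexBetti (⨁ fun i : Fin 2 => C (![j₁, j₂] i)).X (2 * ((d.minFac + 1) / 2)), IsRationalClass c ∧
        IsOfHodgeType (⨁ fun i : Fin 2 => C (![j₁, j₂] i)).dim (⨁ fun i : Fin 2 => C (![j₁, j₂] i)).X (2 * ((d.minFac + 1) / 2))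
          ((d.minFac + 1) / 2) ((d.minFac + 1) / 2) c ∧
        c ∉ divisorClassesSpan (⨁ fun i : Fin 2 => C (![j₁, j₂] i)).X (⨁ fun i : Fin 2 => C (![j₁, j₂] i)).dim ((d.minFac + 1) / 2) := by
  obtain ⟨hp, -, -, h3n, -, -⟩ := minFac_data' hodd hprime h1
  have hp3 : 3 ≤ d.minFac := by
    have := hp.two_le
    have hp2 : d.minFac ≠ 2 := fun h => (Nat.not_even_iff_odd.2 hodd) (even_iff_two_dvd.2 (h ▸ Nat.minFac_dvd d))
    omega
  have hd3 : 3 ≤ d := le_trans hp3 (Nat.minFac_le (by omega))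
  obtain ⟨j₁, hj₁⟩ := (hlev d).2 ⟨hdm, hd3⟩
  obtain ⟨j₂, hj₂⟩ := (hlev (d / d.minFac)).2 ⟨dvd_trans (Nat.div_dvd_of_dvd (Nat.minFac_dvd d)) hdm, h3n⟩
  exact ⟨j₁, j₂, hj₁, hj₂, exists_exceptional_pair_of_lev_eq_odd_composite hodd hprime h1 hΨ hC hj₁ hj₂⟩

/-- **THE EXCEPTIONAL HODGE CLASSES OF THE DEGENERATE `J_m` LOCATED ON AT MOST TWO PIECES.**  For `m ≥ 3` with an odd composite divisor, or
`4p ∣ m` (`p ≥ 7` prime), or `40 ∣ m`, or `48 ∣ m` — by F38 exactly the `m ≥ 3` outside `{p, 2p, 2^k, m ∣ 24, 20}` — the Thm.-3.0 family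
`(C_j)_j` of `J_m` carries a rational `(r,r)`-class outside `𝓓ʳ ⊗ ℂ` on ONE piece or on the product of TWO pieces, explicitly:
`X_d × X_{d / minFac d}` in codimension `(minFac d + 1)/2` (odd composite `d ∣ m`; Goodson); `X_{4p}` in codimension `(p−1)/2` (`p ≡ 1 (mod 4)`) or
`X_4 × X_{4p}` in codimension `(p+1)/4` (`p ≡ 3 (mod 4)`) (F39); `X_8 × X_{40}` in codimension `3` (`40 ∣ m`); `X_{16} × X_{48}` in codimension `2`
(`48 ∣ m`).  ASSEMBLED (Pohlmann ∕ Gao–Ullmo + GGL Lemma 11–12 + Goodson Thm. 1.1); the locations at `40`, `48` are kernel-checked certificates,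
not printed. [cite: GalleseGoodsonLombardo2024, §1 (p. 4) and §3 Thm. 3.0] [cite: Goodson2024DegeneracyFermat, Thm. 1.1]
[cite: GaoUllmo2025, Thm. 3.1] [cite: Gordon1999HodgeAVSurvey, 9.2.2 and §9.3] -/
theorem exists_exceptional_located {m : ℕ}
    (hm : (∃ d, d ∣ m ∧ Odd d ∧ ¬d.Prime ∧ 1 < d) ∨ (∃ p, p.Prime ∧ 7 ≤ p ∧ 4 * p ∣ m) ∨ 40 ∣ m ∨ 48 ∣ m)
    (hlev : ∀ d, (∃ j, lev j = d) ↔ d ∣ m ∧ 3 ≤ d)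
    (hΨ : ∀ j (σ : F j →+* ℂ), σ ∈ (Ψ j).1 ↔ 2 * (expOf (lev j) (F j) σ).val < lev j)
    (hC : ∀ j, IsCMTypeRealisation (Ψ j) (C j) (ιC j) (θC j)) :
    (∃ d, d ∣ m ∧ Odd d ∧ ¬d.Prime ∧ 1 < d ∧ ∃ j₁ j₂, lev j₁ = d ∧ lev j₂ = d / d.minFac ∧
      ∃ c : complexBetti (⨁ fun i : Fin 2 => C (![j₁, j₂] i)).X (2 * ((d.minFac + 1) / 2)), IsRationalClass c ∧
        IsOfHodgeType (⨁ fun i : Fin 2 => C (![j₁, j₂] i)).dim (⨁ fun i : Fin 2 => C (![j₁, j₂] i)).X (2 * ((d.minFac + 1) / 2))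
          ((d.minFac + 1) / 2) ((d.minFac + 1) / 2) c ∧
        c ∉ divisorClassesSpan (⨁ fun i : Fin 2 => C (![j₁, j₂] i)).X (⨁ fun i : Fin 2 => C (![j₁, j₂] i)).dim ((d.minFac + 1) / 2)) ∨
    (∃ p, p.Prime ∧ 7 ≤ p ∧ 4 * p ∣ m ∧
      ((p % 4 = 1 ∧ ∃ j, lev j = 4 * p ∧ (C j).dim = p - 1 ∧ ∃ c : complexBetti (C j).X (2 * ((p - 1) / 2)), IsRationalClass c ∧
        IsOfHodgeType (C j).dim (C j).X (2 * ((p - 1) / 2)) ((p - 1) / 2) ((p - 1) / 2) c ∧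
        c ∉ divisorClassesSpan (C j).X (C j).dim ((p - 1) / 2)) ∨
      (p % 4 = 3 ∧ ∃ j₀ j₁, lev j₀ = 4 ∧ lev j₁ = 4 * p ∧ (⨁ fun i : Fin 2 => C (![j₀, j₁] i)).dim = p ∧
        ∃ c : complexBetti (⨁ fun i : Fin 2 => C (![j₀, j₁] i)).X (2 * ((p + 1) / 4)), IsRationalClass c ∧
          IsOfHodgeType (⨁ fun i : Fin 2 => C (![j₀, j₁] i)).dim (⨁ fun i : Fin 2 => C (![j₀, j₁] i)).X (2 * ((p + 1) / 4))
            ((p + 1) / 4) ((p + 1) / 4) c ∧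
          c ∉ divisorClassesSpan (⨁ fun i : Fin 2 => C (![j₀, j₁] i)).X (⨁ fun i : Fin 2 => C (![j₀, j₁] i)).dim ((p + 1) / 4)))) ∨
    (40 ∣ m ∧ ∃ j₁ j₂, lev j₁ = 8 ∧ lev j₂ = 40 ∧ (⨁ fun i : Fin 2 => C (![j₁, j₂] i)).dim = 10 ∧
      ∃ c : complexBetti (⨁ fun i : Fin 2 => C (![j₁, j₂] i)).X (2 * 3), IsRationalClass c ∧
        IsOfHodgeType (⨁ fun i : Fin 2 => C (![j₁, j₂] i)).dim (⨁ fun i : Fin 2 => C (![j₁, j₂] i)).X (2 * 3) 3 3 c ∧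
        c ∉ divisorClassesSpan (⨁ fun i : Fin 2 => C (![j₁, j₂] i)).X (⨁ fun i : Fin 2 => C (![j₁, j₂] i)).dim 3) ∨
    (48 ∣ m ∧ ∃ j₁ j₂, lev j₁ = 16 ∧ lev j₂ = 48 ∧ (⨁ fun i : Fin 2 => C (![j₁, j₂] i)).dim = 12 ∧
      ∃ c : complexBetti (⨁ fun i : Fin 2 => C (![j₁, j₂] i)).X (2 * 2), IsRationalClass c ∧
        IsOfHodgeType (⨁ fun i : Fin 2 => C (![j₁, j₂] i)).dim (⨁ fun i : Fin 2 => C (![j₁, j₂] i)).X (2 * 2) 2 2 c ∧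
        c ∉ divisorClassesSpan (⨁ fun i : Fin 2 => C (![j₁, j₂] i)).X (⨁ fun i : Fin 2 => C (![j₁, j₂] i)).dim 2) := by
  rcases hm with ⟨d, hdm, hodd, hprime, h1⟩ | ⟨p, hp, hp7, hpm⟩ | h40 | h48
  · exact Or.inl ⟨d, hdm, hodd, hprime, h1, exists_exceptional_pair_of_odd_composite_dvd hdm hodd hprime h1 hlev hΨ hC⟩
  · exact Or.inr (Or.inl ⟨p, hp, hp7, hpm, exists_exceptional_located_of_fourMulPrime_dvd hp hp7 hpm hlev hΨ hC⟩)
  · exact Or.inr (Or.inr (Or.inl ⟨h40, exists_exceptional_pair_of_forty_dvd h40 hlev hΨ hC⟩))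
  · exact Or.inr (Or.inr (Or.inr ⟨h48, exists_exceptional_pair_of_fortyEight_dvd h48 hlev hΨ hC⟩))

end FamilyPair

section FamilyWhole

variable {κ : Type} [Fintype κ] [DecidableEq κ] {lev : κ → ℕ} [∀ j, NeZero (lev j)] {F : κ → Type} [∀ j, Field (F j)]
  [∀ j, NumberField (F j)] [∀ j, IsCyclotomicExtension {lev j} ℚ (F j)] {Ψ : ∀ j, CMType (F j)} {C : κ → AbelianVariety ℂ}
  {ιC : ∀ j, 𝓞 (F j) →+* End (C j)} {θC : ∀ j, F j →+* Module.End ℂ (complexBetti (C j).X 1)}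

omit [DecidableEq κ] [∀ j, NeZero (lev j)] [∀ j, NumberField (F j)] [∀ j, IsCyclotomicExtension {lev j} ℚ (F j)] in
/-- An exceptional Hodge class on one summand `C_j` is an exceptional Hodge class on `⨁_j C_j` (`ι_j ≫ π_j = 𝟙`). [cite: Gordon1999HodgeAVSurvey, 7.6.1]
[cite: vanGeemen1994HodgeAV, §3.6–3.7 (p. 236)] -/
theorem exists_exceptional_biproduct_of_summand (j : κ) {p : ℕ}
    (h : ∃ c : complexBetti (C j).X (2 * p), IsRationalClass c ∧ IsOfHodgeType (C j).dim (C j).X (2 * p) p p c ∧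
      c ∉ divisorClassesSpan (C j).X (C j).dim p) :
    ∃ c : complexBetti (⨁ C).X (2 * p), IsRationalClass c ∧ IsOfHodgeType (⨁ C).dim (⨁ C).X (2 * p) p p c ∧
      c ∉ divisorClassesSpan (⨁ C).X (⨁ C).dim p :=
  exists_exceptional_of_comp_eq_nsmul_id (biproduct.ι C j) (biproduct.π C j) one_ne_zero
    (by rw [one_smul, biproduct.ι_π_self]) h

omit [∀ j, NeZero (lev j)] [∀ j, NumberField (F j)] [∀ j, IsCyclotomicExtension {lev j} ℚ (F j)] in
/-- An exceptional Hodge class on a two-member sub-biproduct `C_{j₁} ⊕ C_{j₂}` (`j₁ ≠ j₂`) is an exceptional Hodge class on `⨁_j C_j`.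
[cite: Gordon1999HodgeAVSurvey, 7.6.1] [cite: vanGeemen1994HodgeAV, §3.6–3.7 (p. 236)] -/
theorem exists_exceptional_biproduct_of_pair {j₁ j₂ : κ} (hne : j₁ ≠ j₂) {p : ℕ}
    (h : ∃ c : complexBetti (⨁ fun i : Fin 2 => C (![j₁, j₂] i)).X (2 * p), IsRationalClass c ∧
      IsOfHodgeType (⨁ fun i : Fin 2 => C (![j₁, j₂] i)).dim (⨁ fun i : Fin 2 => C (![j₁, j₂] i)).X (2 * p) p p c ∧
      c ∉ divisorClassesSpan (⨁ fun i : Fin 2 => C (![j₁, j₂] i)).X (⨁ fun i : Fin 2 => C (![j₁, j₂] i)).dim p) :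
    ∃ c : complexBetti (⨁ C).X (2 * p), IsRationalClass c ∧ IsOfHodgeType (⨁ C).dim (⨁ C).X (2 * p) p p c ∧
      c ∉ divisorClassesSpan (⨁ C).X (⨁ C).dim p := by
  have hv : Function.Injective (![j₁, j₂] : Fin 2 → κ) := by
    intro a b hab
    fin_cases a <;> fin_cases b
    · rfl
    · exact absurd hab hne
    · exact absurd hab.symm hne
    · rfl
  exact exists_exceptional_biproduct_of_comp_injective C hv h

/-- Every `m ≥ 3` is in the positive list or satisfies one of the four degeneracy conditions (private copy of the F38 helper). [folklore] -/
private theorem levels_dichotomy' {m : ℕ} (hm : 3 ≤ m) :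
    ((m.Prime ∧ m ≠ 2) ∨ (∃ p, p.Prime ∧ p ≠ 2 ∧ m = 2 * p) ∨ (∃ k, 2 ≤ k ∧ m = 2 ^ k) ∨ (3 ≤ m ∧ m ∣ 24) ∨ m = 20) ∨
      ((∃ d, d ∣ m ∧ Odd d ∧ ¬d.Prime ∧ 1 < d) ∨ (∃ p, p.Prime ∧ 7 ≤ p ∧ 4 * p ∣ m) ∨ 40 ∣ m ∨ 48 ∣ m) := by
  obtain ⟨a, n, hn, rfl⟩ := Nat.exists_eq_two_pow_mul_odd (n := m) (by omega)
  obtain ⟨c, rfl⟩ := hn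
  by_cases h1 : c = 0
  · subst h1
    refine Or.inl (Or.inr (Or.inr (Or.inl ⟨a, ?_, by ring⟩)))
    rcases a with _ | _ | a
    · norm_num at hm
    · norm_num at hm
    · omega
  by_cases hp : (2 * c + 1).Prime
  · have hn2 : 2 * c + 1 ≠ 2 := by omega
    rcases a with _ | _ | _ | a
    · exact Or.inl (Or.inl ⟨by simpa using hp, by simp⟩)
    · exact Or.inl (Or.inr (Or.inl ⟨2 * c + 1, hp, hn2, by ring⟩))
    · by_cases h3 : c = 1
      · subst h3; exact Or.inl (Or.inr (Or.inr (Or.inr (Or.inl ⟨by norm_num, by norm_num⟩))))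
      by_cases h5 : c = 2
      · subst h5; exact Or.inl (Or.inr (Or.inr (Or.inr (Or.inr (by norm_num)))))
      exact Or.inr (Or.inr (Or.inl ⟨2 * c + 1, hp, by omega, ⟨1, by ring⟩⟩))
    · by_cases h3 : c = 1
      · subst h3
        rcases a with _ | a
        · exact Or.inl (Or.inr (Or.inr (Or.inr (Or.inl ⟨by norm_num, by norm_num⟩))))
        · exact Or.inr (Or.inr (Or.inr (Or.inr ⟨2 ^ a, by ring⟩)))
      by_cases h5 : c = 2
      · subst h5; exact Or.inr (Or.inr (Or.inr (Or.inl ⟨2 ^ a, by ring⟩)))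
      exact Or.inr (Or.inr (Or.inl ⟨2 * c + 1, hp, by omega, ⟨2 ^ (a + 1), by ring⟩⟩))
  · exact Or.inr (Or.inl ⟨2 * c + 1, Dvd.intro_left _ rfl, ⟨c, rfl⟩, hp, by omega⟩)

/-- **`J_m` ITSELF CARRIES AN EXCEPTIONAL HODGE CLASS** for every such `m` (the located class ascends from the one or two pieces to the
biproduct `⨁_j C_j` along the retraction): **the Hodge ring of `J_m` is NOT generated by divisor classes** — GGL's «in most cases the Hodge ring
of `J_m` contains exceptional Hodge cycles» with the exact list of cases.  F38 had only: SOME POWER of `J_m` carries one.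
[cite: GalleseGoodsonLombardo2024, §1 (p. 4) and §3 Thm. 3.0] [cite: Goodson2024DegeneracyFermat, Thm. 1.1] [cite: Gordon1999HodgeAVSurvey, 7.6.1 and 9.2.2] -/
theorem exists_exceptional_biproduct_of_levels {m : ℕ}
    (hm : (∃ d, d ∣ m ∧ Odd d ∧ ¬d.Prime ∧ 1 < d) ∨ (∃ p, p.Prime ∧ 7 ≤ p ∧ 4 * p ∣ m) ∨ 40 ∣ m ∨ 48 ∣ m)
    (hlev : ∀ d, (∃ j, lev j = d) ↔ d ∣ m ∧ 3 ≤ d)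
    (hΨ : ∀ j (σ : F j →+* ℂ), σ ∈ (Ψ j).1 ↔ 2 * (expOf (lev j) (F j) σ).val < lev j)
    (hC : ∀ j, IsCMTypeRealisation (Ψ j) (C j) (ιC j) (θC j)) :
    ∃ (r : ℕ) (c : complexBetti (⨁ C).X (2 * r)), IsRationalClass c ∧ IsOfHodgeType (⨁ C).dim (⨁ C).X (2 * r) r r c ∧
      c ∉ divisorClassesSpan (⨁ C).X (⨁ C).dim r := by
  rcases exists_exceptional_located hm hlev hΨ hC with
    ⟨d, -, -, -, h1, j₁, j₂, hj₁, hj₂, h⟩ | ⟨p, hp, hp7, -, ⟨-, j, -, -, h⟩ | ⟨-, j₀, j₁, hj₀, hj₁, -, h⟩⟩ |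
    ⟨-, j₁, j₂, hj₁, hj₂, -, h⟩ | ⟨-, j₁, j₂, hj₁, hj₂, -, h⟩
  · have hne : j₁ ≠ j₂ := by
      rintro rfl
      rw [hj₁] at hj₂
      have hp : 1 < d.minFac := (Nat.minFac_prime (by omega)).one_lt
      have : d / d.minFac < d := Nat.div_lt_self (by omega) hp
      omega
    exact ⟨_, exists_exceptional_biproduct_of_pair hne h⟩
  · exact ⟨_, exists_exceptional_biproduct_of_summand j h⟩
  · have hne : j₀ ≠ j₁ := by rintro rfl; rw [hj₀] at hj₁; omega
    exact ⟨_, exists_exceptional_biproduct_of_pair hne h⟩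
  · have hne : j₁ ≠ j₂ := by rintro rfl; rw [hj₁] at hj₂; omega
    exact ⟨_, exists_exceptional_biproduct_of_pair hne h⟩
  · have hne : j₁ ≠ j₂ := by rintro rfl; rw [hj₁] at hj₂; omega
    exact ⟨_, exists_exceptional_biproduct_of_pair hne h⟩

/-- **`J_m` IS DEGENERATE — NOT MERELY STABLY DEGENERATE — for every such `m`**: `B(⨁_j C_j) ≠ D(⨁_j C_j)`.
[cite: GalleseGoodsonLombardo2024, §1 (p. 4) and §3 Thm. 3.0] [cite: Goodson2024DegeneracyFermat, Thm. 1.1] [cite: Gordon1999HodgeAVSurvey, 7.6.1] -/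
theorem not_isDivisorGenerated_biproduct_of_levels {m : ℕ}
    (hm : (∃ d, d ∣ m ∧ Odd d ∧ ¬d.Prime ∧ 1 < d) ∨ (∃ p, p.Prime ∧ 7 ≤ p ∧ 4 * p ∣ m) ∨ 40 ∣ m ∨ 48 ∣ m)
    (hlev : ∀ d, (∃ j, lev j = d) ↔ d ∣ m ∧ 3 ≤ d)
    (hΨ : ∀ j (σ : F j →+* ℂ), σ ∈ (Ψ j).1 ↔ 2 * (expOf (lev j) (F j) σ).val < lev j)
    (hC : ∀ j, IsCMTypeRealisation (Ψ j) (C j) (ιC j) (θC j)) : ¬IsDivisorGenerated (⨁ C) := by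
  obtain ⟨r, c, hcQ, hcH, hcD⟩ := exists_exceptional_biproduct_of_levels hm hlev hΨ hC
  exact fun h => hcD (h r c hcQ hcH)

/-- **THE HODGE RING OF `J_m` IS GENERATED BY DIVISOR CLASSES iff `m ∈ {p, 2p, 2^k (k ≥ 2)} ∪ {m ∣ 24} ∪ {20}`** (`m ≥ 3`; `J_m` = the biproduct
of the Thm.-3.0 family, one member at each divisor `e ≥ 3` of `m`, distinct levels): for these `m` F35 ∕ F38 give `𝓑 = 𝓓` on all powers; for every
other `m` §4 puts an exceptional Hodge class on `J_m` itself.  In particular **`B(J_m) = D(J_m)` iff `J_m` is stably nondegenerate** — for the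
`J_m` degeneracy never needs a power to show.  ASSEMBLED; GGL print «in most cases the Hodge ring of `J_m` contains exceptional Hodge cycles».
[cite: GalleseGoodsonLombardo2024, §1 (pp. 4–5) and §3 Thm. 3.0] [cite: Goodson2024DegeneracyFermat, Thm. 1.1] [cite: Gordon1999HodgeAVSurvey, 7.4–7.6.1 and 9.2.2]
[cite: Kubota1965, §4 Lemma 2] -/
theorem isDivisorGenerated_biproduct_iff {m : ℕ} (hm : 3 ≤ m) (hlev : ∀ d, (∃ j, lev j = d) ↔ d ∣ m ∧ 3 ≤ d)
    (hinj : Function.Injective lev) (hΨ : ∀ j (σ : F j →+* ℂ), σ ∈ (Ψ j).1 ↔ 2 * (expOf (lev j) (F j) σ).val < lev j)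
    (hC : ∀ j, IsCMTypeRealisation (Ψ j) (C j) (ιC j) (θC j)) :
    IsDivisorGenerated (⨁ C) ↔
      (m.Prime ∧ m ≠ 2) ∨ (∃ p, p.Prime ∧ p ≠ 2 ∧ m = 2 * p) ∨ (∃ k, 2 ≤ k ∧ m = 2 ^ k) ∨ (3 ≤ m ∧ m ∣ 24) ∨ m = 20 := by
  refine ⟨fun h => ?_, fun h => ((isStablyNondegenerate_biproduct_iff hm hlev hinj hΨ hC).2 h).isDivisorGenerated⟩
  rcases levels_dichotomy' hm with hpos | hneg
  · exact hpos
  · exact absurd h (not_isDivisorGenerated_biproduct_of_levels hneg hlev hΨ hC)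

/-- **`B(J_m) = D(J_m)` iff `J_m` is stably nondegenerate** (`m ≥ 3`). [cite: GalleseGoodsonLombardo2024, §1 (pp. 4–5) and §3 Thm. 3.0]
[cite: Gordon1999HodgeAVSurvey, 7.4–7.6.1] -/
theorem isDivisorGenerated_biproduct_iff_isStablyNondegenerate {m : ℕ} (hm : 3 ≤ m) (hlev : ∀ d, (∃ j, lev j = d) ↔ d ∣ m ∧ 3 ≤ d)
    (hinj : Function.Injective lev) (hΨ : ∀ j (σ : F j →+* ℂ), σ ∈ (Ψ j).1 ↔ 2 * (expOf (lev j) (F j) σ).val < lev j)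
    (hC : ∀ j, IsCMTypeRealisation (Ψ j) (C j) (ιC j) (θC j)) :
    IsDivisorGenerated (⨁ C) ↔ IsStablyNondegenerate (⨁ C) := by
  rw [isDivisorGenerated_biproduct_iff hm hlev hinj hΨ hC, isStablyNondegenerate_biproduct_iff hm hlev hinj hΨ hC]

end FamilyWhole

end HyperellipticJacobian

end Literature.AlgebraicGeometry.ComplexMultiplication

end
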